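import Literature.NumberTheory.Automorphic.MeyerRatChain
import Literature.NumberTheory.Automorphic.MeyerRatDivisibilityAvg
import Literature.NumberTheory.Automorphic.MeyerZetaOrders
import Literature.NumberTheory.Automorphic.MeyerTwistedDifference
import Literature.NumberTheory.Automorphic.MeyerCommonKernel
import Literature.NumberTheory.Automorphic.MeyerThetaFunctionalEquation
import Literature.NumberTheory.Automorphic.MeyerSummationPoisson
import Mathlib.NumberTheory.Real.Irrational
import HarnessLib

/-!
# Meyer's spectral realisation theorem for `K = ℚ`: `mult(|x|^s, π₋) = ord_s Λ`

Topic `NumberTheory/Automorphic`; namespace `Literature.NumberTheory.Automorphic.Meyer`. Sibling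
PROOF file DISCHARGING the named fact `Meyer.spectralRealisation_rat` of
`MeyerDifferenceRepresentation.lean` [Meyer2005, Thm. 5.11]: for the self-dual Haar measure on
`𝔸_ℚ` and `s ∉ {0, 1}`, the algebraic multiplicity of the quasi-character `|x|^s` in Meyer's
global difference representation `π₋` on `H⁰₋ = (H₊ + H₋)/H₊` equals the order of vanishing of
the completed zeta function `Λ` at `s`, and `1, |x|` are not in the spectrum
(`spectralRealisation_rat_holds`, at the end of the file).

The proof analyses joint (generalised) eigenvectors directly through the Fourier–Laplace
(Mellin) transform on the unramified part of `C_ℚ ≅ ℝ_{>0} × Ẑˣ`, instead of Meyer's nuclear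
operator / trace machinery:

1. **Lower bound** (`analyticOrderAt_completedZeta_le_algMultiplicity`, §LowerBound): the Jordan
   chain `R_s^j h₀` (`MeyerRatChain`) of the theta vector `h₀ = Σ(G₀ ⊗ 1_Ẑ)` of a compact test
   function spans a finite-dimensional `π₋`-invariant subspace of the generalised eigenspace
   (defect identity), of dimension `≥ ord_s Λ` by DIVISIBILITY of Mellin transforms of
   `H₊ ∩ H₋` by `ζ` (`MeyerRatDivisibilityAvg`, [Meyer2005, Lemma 5.3]).
2. **Key lemma** (`exists_theta_of_mellin_identities`, `toHzero_eq_zero_of_eigenvector`, §Key):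
   a joint eigenvector `[i₋ f]` (`f ∈ H₋` unramified) satisfies
   `(e^{az} - e^{as}) f̂ = ζ · Mκ_a` with even Schwartz `κ_a`; comparing `a = 1` and `a = √2`
   (irrational) kills `Mκ_1` at `s + 2πiℤ`, the twisted difference equation is solved in `𝒮(ℝ)`
   (`MeyerTwistedDifference`, [Meyer2005, Lemma 5.10]) and `f = Σ(k ⊗ 1_Ẑ) ∈ H₊ ∩ H₋`, so
   `[i₋ f] = 0` — provided `Re s > 0` and (`s = 1`, or `Re s ≥ 1`, or `ord_s f̂ ≥ ord_s Λ`).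
3. **Upper bound** (`finrank_inf_jointGenEigenspace_le_of`, §UpperBound): the jet map
   `[i₋ f] ↦ (∂ⁱ f̂(s))_{i < m}` on a finite-dimensional invariant part of the generalised
   eigenspace is well defined by divisibility; its kernel is invariant, hence contains a joint
   eigenvector (`MeyerCommonKernel`) which vanishes by the key lemma; so the dimension is `≤ m`.
4. **Left half plane** (§Left): for `Re s ≤ 0` the SECOND component of `i₊` and the symmetry
   `J` (`𝓜(Jf)(z) = 𝓜f(1-z)`) move the problem to `1 - s`, and the real functional equation of
   theta Mellin transforms (`MeyerThetaFunctionalEquation`) brings the conclusion back.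

Everything is proved; the auxiliary definitions are `toHzero` (the map `H₋ → H⁰₋`), `urep`
(chosen unramified representatives) and `jetOf`.

## References

* R. Meyer, *On a representation of the idele class group related to primes and zeros of
  L-functions*, Duke Math. J. 127 (2005) = arXiv:math/0311468, §2.3, §4, Lemma 5.3, Lemma 5.10,
  Thm. 5.11 [Meyer2005].
-/

noncomputable section

open MeasureTheory Set Filter Complex NumberField
open scoped Topology Real FourierTransform

namespace Literature.NumberTheory.Automorphic.Meyer

/-! ## Part 1: the lower bound -/


/-! ### Vanishing of polynomial coefficients from orders of vanishing -/

section PolyOrder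

/-- `1 + x ≥ n + 1` in `ℕ∞` forces `x ≥ n`. [folklore] -/
theorem ENat.le_of_one_add_le {x : ℕ∞} {n : ℕ} (h : ((n + 1 : ℕ) : ℕ∞) ≤ 1 + x) : (n : ℕ∞) ≤ x := by
  induction x using ENat.recTopCoe with
  | top => exact le_top
  | coe k =>
    have : ((n + 1 : ℕ) : ℕ∞) ≤ ((1 + k : ℕ) : ℕ∞) := by simpa using h
    have := ENat.coe_le_coe.mp this
    exact ENat.coe_le_coe.mpr (by omega)

/-- **If `(∑_{k<n} e_k (z-s)^k) · u(z)` vanishes to order `≥ n` at `s` and `u(s) ≠ 0`, then all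
`e_k = 0`.** [folklore] -/
theorem coeff_eq_zero_of_le_analyticOrderAt {u : ℂ → ℂ} {s : ℂ} (hu : AnalyticAt ℂ u s) (hus : u s ≠ 0) :
    ∀ (n : ℕ) (e : ℕ → ℂ),
      (n : ℕ∞) ≤ analyticOrderAt (fun z : ℂ => (∑ k ∈ Finset.range n, e k * (z - s) ^ k) * u z) s →
        ∀ k, k < n → e k = 0
  | 0 => fun _ _ k hk => absurd hk (Nat.not_lt_zero k)
  | n + 1 => fun e h k hk => by
      have han : AnalyticAt ℂ (fun z : ℂ => (∑ k ∈ Finset.range (n + 1), e k * (z - s) ^ k) * u z) s := by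
        fun_prop
      -- the value at `s` vanishes, so `e 0 = 0`
      have hval : e 0 = 0 := by
        have hpos : analyticOrderAt (fun z : ℂ => (∑ k ∈ Finset.range (n + 1), e k * (z - s) ^ k) * u z) s ≠ 0 := by
          intro h0; rw [h0] at h; exact absurd h (by simp)
        have h0 := apply_eq_zero_of_analyticOrderAt_ne_zero han hpos
        simp only [sub_self] at h0
        rw [Finset.sum_eq_single 0 (fun k _ hk => by simp [hk]) (by simp)] at h0
        simp only [pow_zero, mul_one] at h0
        exact (mul_eq_zero.mp h0).resolve_right hus
      -- factor `z - s` and use the induction hypothesis on the shifted coefficients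
      rcases Nat.eq_zero_or_pos k with rfl | hkpos
      · exact hval
      · have hfac : (fun z : ℂ => (∑ k ∈ Finset.range (n + 1), e k * (z - s) ^ k) * u z) =
            (fun z : ℂ => (z - s)) * fun z : ℂ => (∑ k ∈ Finset.range n, e (k + 1) * (z - s) ^ k) * u z := by
          funext z
          rw [Finset.sum_range_succ', hval, zero_mul, add_zero, Pi.mul_apply, Finset.sum_mul, Finset.sum_mul,
            Finset.mul_sum]
          refine Finset.sum_congr rfl fun i _ => ?_
          ring
        rw [hfac, analyticOrderAt_mul (by fun_prop) (by fun_prop)] at h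
        have h1 : analyticOrderAt (fun z : ℂ => z - s) s = 1 := by
          have := analyticOrderAt_pow_sub s 1
          simpa using this
        rw [h1] at h
        have h' := ENat.le_of_one_add_le h
        have := coeff_eq_zero_of_le_analyticOrderAt hu hus n (fun k => e (k + 1)) h' (k - 1) (by omega)
        rwa [show k - 1 + 1 = k by omega] at this

/-- Cancellation of `(z - s)^n` between continuous functions. [folklore] -/
theorem eq_of_pow_sub_mul_eq {F G : ℂ → ℂ} (hF : Continuous F) (hG : Continuous G) (s : ℂ) (n : ℕ)
    (h : ∀ z : ℂ, (z - s) ^ n * F z = (z - s) ^ n * G z) : F = G := by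
  refine Continuous.ext_on (dense_compl_singleton s) hF hG fun z hz => ?_
  have hz' : (z - s) ^ n ≠ 0 := pow_ne_zero _ (sub_ne_zero.mpr hz)
  exact mul_left_cancel₀ hz' (h z)

/-- Reindexing a descending-power sum over `Fin m` as an ascending-power sum over `range m`. [folklore] -/
theorem sum_fin_desc_eq_sum_range (m : ℕ) (d : Fin m → ℂ) (w : ℂ) :
    ∑ i : Fin m, d i * w ^ (m - 1 - (i : ℕ)) =
      ∑ k ∈ Finset.range m, (if h : m - 1 - k < m then d ⟨m - 1 - k, h⟩ else 0) * w ^ k := by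
  set D : ℕ → ℂ := fun j => if h : j < m then d ⟨j, h⟩ else 0 with hD
  have h1 : ∑ i : Fin m, d i * w ^ (m - 1 - (i : ℕ)) = ∑ k ∈ Finset.range m, D k * w ^ (m - 1 - k) := by
    rw [← Fin.sum_univ_eq_sum_range (fun k => D k * w ^ (m - 1 - k)) m]
    refine Finset.sum_congr rfl fun i _ => ?_
    rw [hD]
    simp only [dif_pos i.2]
  rw [h1, ← Finset.sum_range_reflect (fun k => D (m - 1 - k) * w ^ k) m]
  refine Finset.sum_congr rfl fun k hk => ?_
  have hk' := Finset.mem_range.mp hk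
  simp only [hD]
  rw [show m - 1 - (m - 1 - k) = k by omega]

end PolyOrder

/-! ### The lower bound -/

section LowerBound

variable [MeasurableSpace (AdeleRing (𝓞 ℚ) ℚ)] (μ : Measure (AdeleRing (𝓞 ℚ) ℚ))

/-- The linear map `H₋ → H⁰₋ = (H₊ + H₋)/H₊`, `f ↦ [i₋ f]`. [cite: Meyer2005, §5.5] -/
def toHzero : ↥(Hminus ℚ) →ₗ[ℂ] HzeroMinus ℚ μ :=
  (HplusIn ℚ μ).mkQ ∘ₗ
    LinearMap.codRestrict (Hsum ℚ μ) ((iMinus ℚ) ∘ₗ (Hminus ℚ).subtype) fun f => iMinus_mem_Hsum μ f.2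

/-- Unfolding of `toHzero`. [folklore] -/
theorem toHzero_apply (f : ↥(Hminus ℚ)) :
    toHzero μ f = Submodule.Quotient.mk ⟨iMinus ℚ (f : IdeleClassGroup ℚ → ℂ), iMinus_mem_Hsum μ f.2⟩ := rfl

/-- `toHzero f = 0` when `i₋ f ∈ H₊`. [cite: Meyer2005, §5.5] -/
theorem toHzero_eq_zero {f : ↥(Hminus ℚ)} (hf : iMinus ℚ (f : IdeleClassGroup ℚ → ℂ) ∈ Hplus ℚ μ) : toHzero μ f = 0 := by
  rw [toHzero_apply, Submodule.Quotient.mk_eq_zero]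
  exact hf

/-- `toHzero f = 0` forces `i₋ f ∈ H₊`. [cite: Meyer2005, §5.5] -/
theorem iMinus_mem_Hplus_of_toHzero_eq_zero {f : ↥(Hminus ℚ)} (hf : toHzero μ f = 0) :
    iMinus ℚ (f : IdeleClassGroup ℚ → ℂ) ∈ Hplus ℚ μ := by
  rw [toHzero_apply, Submodule.Quotient.mk_eq_zero] at hf
  exact hf

/-- **Equivariance**: `π₋(g) [i₋ f] = [i₋ (λ_g f)]`. [cite: Meyer2005, §5.5] -/
theorem piMinus_toHzero (g : IdeleClassGroup ℚ) (f : ↥(Hminus ℚ)) :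
    piMinus ℚ μ g (toHzero μ f) =
      toHzero μ ⟨classTranslate ℚ g f, classTranslate_mem_ideleClassSchwartzWeighted f.2 g⟩ := by
  rw [toHzero_apply, toHzero_apply, piMinus, Representation.quotient_apply, Submodule.mapQ_apply]
  rfl

variable [BorelSpace (AdeleRing (𝓞 ℚ) ℚ)] [μ.IsAddHaarMeasure]

/-- **THE LOWER BOUND** `ord_s Λ ≤ mult(|x|^s, π₋)` for `s ∉ {0, 1}` (self-dual Haar measure).
[cite: Meyer2005, Thm. 5.11] -/
theorem analyticOrderAt_completedZeta_le_algMultiplicity (hμ : μ (adeleFundamentalDomain ℚ) = 1) {s : ℂ}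
    (h0 : s ≠ 0) (h1 : s ≠ 1) :
    analyticOrderAt completedRiemannZeta s ≤ algMultiplicity (piMinus ℚ μ) (normChar ℚ s) := by
  classical
  by_cases hstrip : 0 < s.re ∧ s.re < 1
  swap
  · rw [analyticOrderAt_completedZeta_eq_zero h0 h1 (by
      by_cases h : 0 < s.re
      · exact Or.inr (not_lt.mp fun h' => hstrip ⟨h, h'⟩)
      · exact Or.inl (not_lt.mp h))]
    exact zero_le
  obtain ⟨hs0, hs1⟩ := hstrip
  /- the test vector `h₀ = Σ(G₀ ⊗ 1_Ẑ)` and the order `J = m + m'` of its Mellin transform at `s` -/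
  set h₀ : IdeleClassGroup ℚ → ℂ := meyerSum ℚ (ratTensor testG₀) with hh₀def
  have hunr₀ := meyerSum_ratTensor_unramified testG₀
  have hh₀ : h₀ ∈ Hminus ℚ := meyerSum_ratTensor_mem_Hminus_of_isCompactTest μ hμ isCompactTest_testG₀ integral_testG₀
  set Z : ℂ → ℂ := mellin (fun t : ℝ => h₀ (posClass (Real.log t))) with hZ
  have hZent : Differentiable ℂ Z := differentiable_mellin_of_mem_Hminus hunr₀ hh₀
  have hZζ : ∀ z : ℂ, 1 < z.re → Z z = riemannZeta z * mellin testG₀ z :=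
    fun z hz => mellin_meyerSum_ratTensor isCompactTest_testG₀ hz
  -- `ord_s Z = ord_s Λ + ord_s MG₀`
  have hordZ : analyticOrderAt Z s = analyticOrderAt completedRiemannZeta s + analyticOrderAt (mellin testG₀) s := by
    set A : ℂ → ℂ := fun z => z * (1 - z) * Z z with hA
    set B : ℂ → ℂ := fun z => zetaTwo z * mellin testG₀ z with hB
    have hopen : IsOpen {z : ℂ | 0 < z.re} := isOpen_lt continuous_const Complex.continuous_re
    have hAd : Differentiable ℂ A := (differentiable_id.mul ((differentiable_const (1 : ℂ)).sub differentiable_id)).mul hZent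
    have hBd : Differentiable ℂ B := differentiable_zetaTwo.mul isCompactTest_testG₀.differentiable_mellin
    have hAB : EqOn A B {z : ℂ | 0 < z.re} := by
      refine eqOn_of_eqOn_one_lt_re hAd.differentiableOn hBd.differentiableOn fun z hz => ?_
      have hz0 : z ≠ 0 := by rintro rfl; norm_num at hz
      have hz1 : z ≠ 1 := by rintro rfl; norm_num at hz
      simp only [hA, hB, hZζ z hz, zetaTwo_eq hz0 hz1]
      ring
    have hev : A =ᶠ[𝓝 s] B := by
      filter_upwards [hopen.mem_nhds (show s ∈ {z : ℂ | 0 < z.re} from hs0)] with z hz using hAB hz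
    have hordA : analyticOrderAt A s = analyticOrderAt Z s := by
      rw [show A = (fun z : ℂ => z * (1 - z)) * Z from rfl, analyticOrderAt_mul (by fun_prop) (hZent.analyticAt s),
        analyticOrderAt_mul_one_sub h0 h1, zero_add]
    rw [← hordA, analyticOrderAt_congr hev, show B = zetaTwo * mellin testG₀ from rfl,
      analyticOrderAt_mul (differentiable_zetaTwo.analyticAt s) (isCompactTest_testG₀.differentiable_mellin.analyticAt s),
      analyticOrderAt_zetaTwo hs0 h1]
  -- finiteness of the orders
  have hΛfin : analyticOrderAt completedRiemannZeta s ≠ ⊤ := by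
    intro htop
    have h2 : analyticOrderAt zetaEntire s = ⊤ := by rw [analyticOrderAt_zetaEntire h0 h1, htop]
    rw [analyticOrderAt_eq_top] at h2
    have hana : AnalyticOnNhd ℂ zetaEntire univ := differentiable_zetaEntire.differentiableOn.analyticOnNhd isOpen_univ
    have h := hana.eqOn_zero_of_preconnected_of_eventuallyEq_zero isPreconnected_univ (mem_univ s) h2 (mem_univ 2)
    have h2' : zetaEntire 2 = 2 * (1 - 2) * completedRiemannZeta 2 := zetaEntire_eq two_ne_zero (by norm_num)
    rw [h2'] at h
    have hΛ2 : completedRiemannZeta 2 ≠ 0 := completedZeta_ne_zero_of_not_mem_strip two_ne_zero (by norm_num) (Or.inr (by norm_num))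
    exact hΛ2 (by have h' := h; norm_num at h'; exact h')
  have hGfin : analyticOrderAt (mellin testG₀) s ≠ ⊤ := analyticOrderAt_mellin_testG₀_ne_top s
  obtain ⟨m, hm⟩ := ENat.ne_top_iff_exists.mp hΛfin
  obtain ⟨m', hm'⟩ := ENat.ne_top_iff_exists.mp hGfin
  set J : ℕ := m + m' with hJdef
  have hJ : analyticOrderAt Z s = J := by rw [hordZ, ← hm, ← hm', hJdef]; rfl
  rw [← hm]
  -- trivial when `m = 0`
  rcases Nat.eq_zero_or_pos m with hm0 | hmpos
  · rw [hm0]; exact zero_le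
  /- the chain and its classes -/
  have hpack := chain_package hunr₀ hh₀ hJ
  have hunrj := chain_unramified s h₀ hunr₀
  let r : ℕ → ↥(Hminus ℚ) := fun j => if h : j ≤ J then ⟨chain s h₀ j, (hpack j h).1⟩ else 0
  have hr : ∀ j, (hj : j ≤ J) → (r j : IdeleClassGroup ℚ → ℂ) = chain s h₀ j := by
    intro j hj; simp only [r, dif_pos hj]
  let v : ℕ → HzeroMinus ℚ μ := fun j => toHzero μ (r j)
  let Wsp : ℕ → Submodule ℂ (HzeroMinus ℚ μ) := fun i => Submodule.span ℂ (v '' Set.Icc 1 i)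
  set W := Wsp J with hWdef
  haveI : FiniteDimensional ℂ W := FiniteDimensional.span_of_finite ℂ ((Set.finite_Icc 1 J).image v)
  have hWmono : ∀ i i', i ≤ i' → Wsp i ≤ Wsp i' := fun i i' h =>
    Submodule.span_mono (Set.image_mono (Set.Icc_subset_Icc_right h))
  have hvmem : ∀ i j, 1 ≤ j → j ≤ i → v j ∈ Wsp i := fun i j h1j hji =>
    Submodule.subset_span ⟨j, ⟨h1j, hji⟩, rfl⟩
  /- the action of `π₋(g)` on the classes: `π₋(g) v_{k+1} - c v_{k+1} ∈ W_k` -/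
  have haction : ∀ (g : IdeleClassGroup ℚ) (k : ℕ), k + 1 ≤ J →
      piMinus ℚ μ g (v (k + 1)) - normChar ℚ s g • v (k + 1) ∈ Wsp k := by
    intro g k hk
    have hcn : normChar ℚ s g = cexp ((Real.log (classNorm ℚ g) : ℂ) * s) := normChar_eq_exp s g
    have hdef := classTranslate_chain_sub_eq μ hμ isCompactTest_testG₀ integral_testG₀ hs1 hJ g hk
    -- the defect vector and its class
    have hGk : IsCompactTest (defectTest testG₀ s (Real.log (classNorm ℚ g)) k) :=
      isCompactTest_defectTest s (Real.log (classNorm ℚ g)) isCompactTest_testG₀ k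
    have hGk0 : ∫ t : ℝ, defectTest testG₀ s (Real.log (classNorm ℚ g)) k t = 0 :=
      integral_defectTest_eq_zero s (Real.log (classNorm ℚ g)) isCompactTest_testG₀ integral_testG₀ k
    have hnmem : meyerSum ℚ (ratTensor (defectTest testG₀ s (Real.log (classNorm ℚ g)) k)) ∈ Hminus ℚ :=
      meyerSum_ratTensor_mem_Hminus_of_isCompactTest μ hμ hGk hGk0
    have hnplus : iMinus ℚ (meyerSum ℚ (ratTensor (defectTest testG₀ s (Real.log (classNorm ℚ g)) k))) ∈ Hplus ℚ μ :=
      iMinus_meyerSum_ratTensor_mem_Hplus_of_isCompactTest μ hμ hGk hGk0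
    -- the combination `S = ∑_{i<k} E_i(s) r_{k-i}` as an element of `H₋`
    set S : ↥(Hminus ℚ) := ∑ i ∈ Finset.range k, expSlope (Real.log (classNorm ℚ g)) s i s • r (k - i) with hS
    -- identity in `H₋`: `λ_g r_{k+1} = c r_{k+1} + (S + n)`
    have hfun : (⟨classTranslate ℚ g (r (k + 1)), classTranslate_mem_ideleClassSchwartzWeighted (r (k + 1)).2 g⟩ : ↥(Hminus ℚ)) =
        cexp ((Real.log (classNorm ℚ g) : ℂ) * s) • r (k + 1) +
          (S + ⟨meyerSum ℚ (ratTensor (defectTest testG₀ s (Real.log (classNorm ℚ g)) k)), hnmem⟩) := by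
      apply Subtype.ext
      funext x
      have hx := congrFun hdef x
      simp only [Pi.sub_apply, Pi.add_apply, Pi.smul_apply, smul_eq_mul, ← hh₀def] at hx
      simp only [Submodule.coe_add, Submodule.coe_smul, Submodule.coe_sum, hS, Pi.add_apply, Pi.smul_apply,
        Finset.sum_apply, smul_eq_mul, hr (k + 1) hk]
      have hsum : ∑ i ∈ Finset.range k, expSlope (Real.log (classNorm ℚ g)) s i s * (r (k - i) : IdeleClassGroup ℚ → ℂ) x =
          ∑ i ∈ Finset.range k, expSlope (Real.log (classNorm ℚ g)) s i s * chain s h₀ (k - i) x :=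
        Finset.sum_congr rfl fun i hi => by rw [hr (k - i) (by have := Finset.mem_range.mp hi; omega)]
      rw [hsum]
      linear_combination hx
    rw [piMinus_toHzero, hfun, map_add, map_add, map_smul, hcn,
      toHzero_eq_zero μ (f := ⟨_, hnmem⟩) hnplus, add_zero, add_sub_cancel_left, hS, map_sum]
    refine Submodule.sum_mem _ fun i hi => ?_
    rw [map_smul]
    have hik := Finset.mem_range.mp hi
    exact Submodule.smul_mem _ _ (hvmem k (k - i) (by omega) (by omega))
  /- invariance of `W` -/
  have hinv : ∀ g : IdeleClassGroup ℚ, W ≤ W.comap (piMinus ℚ μ g) := by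
    intro g
    rw [hWdef]
    refine Submodule.span_le.mpr ?_
    rintro _ ⟨j, ⟨h1j, hjJ⟩, rfl⟩
    rw [SetLike.mem_coe, Submodule.mem_comap]
    obtain ⟨k, rfl⟩ : ∃ k, j = k + 1 := ⟨j - 1, by omega⟩
    have h := haction g k hjJ
    have hmem : normChar ℚ s g • v (k + 1) ∈ Wsp J := Submodule.smul_mem _ _ (hvmem J (k + 1) h1j hjJ)
    have := Submodule.add_mem _ (hWmono k J (by omega) h) hmem
    rwa [sub_add_cancel] at this
  /- nilpotency: `(π₋(g) - c)^i` kills `W_i`, hence `W ≤ jointGenEigenspace` -/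
  have hnil : ∀ (g : IdeleClassGroup ℚ) (i : ℕ), i ≤ J → ∀ w ∈ Wsp i,
      ((piMinus ℚ μ g - normChar ℚ s g • (1 : Module.End ℂ (HzeroMinus ℚ μ))) ^ i) w = 0 := by
    intro g i
    induction i with
    | zero =>
        intro _ w hw
        have : Wsp 0 = ⊥ := by
          show Submodule.span ℂ (v '' Set.Icc 1 0) = ⊥
          rw [Set.Icc_eq_empty (by norm_num), Set.image_empty, Submodule.span_empty]
        rw [this, Submodule.mem_bot] at hw
        rw [hw, map_zero]
    | succ i ih =>
        intro hi w hw
        -- `(π - c) w ∈ W_i`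
        have hstep : (piMinus ℚ μ g - normChar ℚ s g • (1 : Module.End ℂ (HzeroMinus ℚ μ))) w ∈ Wsp i := by
          refine Submodule.span_induction (p := fun w _ =>
            (piMinus ℚ μ g - normChar ℚ s g • (1 : Module.End ℂ (HzeroMinus ℚ μ))) w ∈ Wsp i) ?_ ?_ ?_ ?_ hw
          · rintro _ ⟨j, ⟨h1j, hji⟩, rfl⟩
            obtain ⟨k, rfl⟩ : ∃ k, j = k + 1 := ⟨j - 1, by omega⟩
            have h := haction g k (by omega)
            simp only [LinearMap.sub_apply, LinearMap.smul_apply, Module.End.one_apply]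
            exact hWmono k i (by omega) h
          · simp
          · intro x y _ _ hx hy
            rw [map_add]; exact Submodule.add_mem _ hx hy
          · intro c' x _ hx
            rw [map_smul]; exact Submodule.smul_mem _ _ hx
        rw [pow_succ, Module.End.mul_apply]
        exact ih (by omega) _ hstep
  have hle : W ≤ jointGenEigenspace (piMinus ℚ μ) (normChar ℚ s) := by
    intro w hw
    rw [mem_jointGenEigenspace_iff]
    intro g
    exact ⟨J, hnil g J le_rfl w hw⟩
  /- linear independence of `v_{J-m+1}, …, v_J` -/
  have hmJ : m ≤ J := by omega
  have hli : LinearIndependent ℂ (fun i : Fin m => v (J - m + 1 + i)) := by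
    rw [Fintype.linearIndependent_iff]
    intro d hd i₀
    -- the relation in `H₋`
    set D : ↥(Hminus ℚ) := ∑ i : Fin m, d i • r (J - m + 1 + i) with hDdef
    have hD0 : toHzero μ D = 0 := by
      rw [hDdef, map_sum]
      simp only [map_smul]
      exact hd
    have hDplus := iMinus_mem_Hplus_of_toHzero_eq_zero μ hD0
    have hDfun : (D : IdeleClassGroup ℚ → ℂ) = fun x => ∑ i : Fin m, d i * chain s h₀ (J - m + 1 + i) x := by
      rw [hDdef, Submodule.coe_sum]
      funext x
      simp only [Finset.sum_apply, Submodule.coe_smul, Pi.smul_apply, smul_eq_mul]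
      refine Finset.sum_congr rfl fun i _ => ?_
      rw [hr _ (by omega)]
    have hDunr : ∀ u ∈ integralFiniteUnits ℚ, ∀ x, (D : IdeleClassGroup ℚ → ℂ) (x * finiteUnitClass ℚ u) = (D : IdeleClassGroup ℚ → ℂ) x := by
      intro u hu x
      rw [hDfun]
      simp only [hunrj _ u hu x]
    -- `D = Σ F` for some `F ∈ 𝒮(𝔸)`, so `𝓜D` is divisible by `ζ`
    obtain ⟨F, hF, hDF⟩ := (mem_Hplus_iff (μ := μ)).mp hDplus
    have hDsum : (D : IdeleClassGroup ℚ → ℂ) = meyerSum ℚ F := by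
      have := congrArg Prod.fst hDF
      rw [iMinus_apply] at this
      exact this
    have hSunr : ∀ u ∈ integralFiniteUnits ℚ, ∀ x, meyerSum ℚ F (x * finiteUnitClass ℚ u) = meyerSum ℚ F x := by
      rw [← hDsum]; exact hDunr
    obtain ⟨Q, hQ, hMQ⟩ := exists_mellin_meyerSum_eq_zeta_mul hF hSunr
    have hMD : Differentiable ℂ (mellin (fun t : ℝ => (D : IdeleClassGroup ℚ → ℂ) (posClass (Real.log t)))) :=
      differentiable_mellin_of_mem_Hminus hDunr D.2
    have hordD : analyticOrderAt completedRiemannZeta s ≤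
        analyticOrderAt (mellin (fun t : ℝ => (D : IdeleClassGroup ℚ → ℂ) (posClass (Real.log t)))) s := by
      refine analyticOrderAt_ge_of_eq_zeta_mul hMD hQ (fun z hz => ?_) hs0 hs1
      rw [← hMQ z hz, hDsum]
    -- `𝓜D = (∑ d_i (z-s)^{m-1-i}) · F_J` with `F_J(s) ≠ 0`
    set FJ : ℂ → ℂ := mellin (fun t : ℝ => chain s h₀ J (posClass (Real.log t))) with hFJ
    have hFJent : Differentiable ℂ FJ := differentiable_mellin_of_mem_Hminus (hunrj J) (hpack J le_rfl).1
    have hFJord : analyticOrderAt FJ s = 0 := by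
      have := (hpack J le_rfl).2.2
      simpa using this
    have hFJs : FJ s ≠ 0 := (hFJent.analyticAt s).analyticOrderAt_eq_zero.mp hFJord
    have hFj : ∀ j, j ≤ J → mellin (fun t : ℝ => chain s h₀ j (posClass (Real.log t))) = fun z => (z - s) ^ (J - j) * FJ z := by
      intro j hj
      refine eq_of_pow_sub_mul_eq (differentiable_mellin_of_mem_Hminus (hunrj j) (hpack j hj).1).continuous
        (((continuous_id.sub continuous_const).pow _).mul hFJent.continuous) s j fun z => ?_
      rw [(hpack j hj).2.1 z, ← (hpack J le_rfl).2.1 z, ← hFJ, show J = j + (J - j) by omega, pow_add]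
      simp only [show j + (J - j) - j = J - j by omega]
      ring
    set e : ℕ → ℂ := fun k => if h : m - 1 - k < m then d ⟨m - 1 - k, h⟩ else 0 with he
    have hMDeq : mellin (fun t : ℝ => (D : IdeleClassGroup ℚ → ℂ) (posClass (Real.log t))) =
        fun z => (∑ k ∈ Finset.range m, e k * (z - s) ^ k) * FJ z := by
      funext z
      rw [hDfun, mellin_lincomb_of_mem_Hminus (Finset.univ : Finset (Fin m)) d (fun i _ => hunrj _)
        (fun i _ => (hpack _ (by omega)).1) z]
      have hterm : ∀ i : Fin m, mellin (fun t : ℝ => chain s h₀ (J - m + 1 + (i : ℕ)) (posClass (Real.log t))) z =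
          (z - s) ^ (m - 1 - (i : ℕ)) * FJ z := by
        intro i
        rw [hFj _ (by omega), show J - (J - m + 1 + (i : ℕ)) = m - 1 - (i : ℕ) by omega]
      simp only [hterm]
      rw [he, ← sum_fin_desc_eq_sum_range m d (z - s), Finset.sum_mul]
      refine Finset.sum_congr rfl fun i _ => ?_
      ring
    rw [hMDeq] at hordD
    have hcoef := coeff_eq_zero_of_le_analyticOrderAt (hFJent.analyticAt s) hFJs m e (by rw [hm]; exact hordD)
      (m - 1 - (i₀ : ℕ)) (by omega)
    rw [he] at hcoef
    simp only [show m - 1 - (m - 1 - (i₀ : ℕ)) < m by omega, dif_pos] at hcoef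
    rwa [show (⟨m - 1 - (m - 1 - (i₀ : ℕ)), (by omega : m - 1 - (m - 1 - (i₀ : ℕ)) < m)⟩ : Fin m) = i₀ from
      Fin.ext (by simp only; have := i₀.2; omega)] at hcoef
  /- dimension count -/
  have hcard : (m : ℕ∞) ≤ (Module.finrank ℂ W : ℕ∞) := by
    have hsub : Submodule.span ℂ (Set.range fun i : Fin m => v (J - m + 1 + i)) ≤ W := by
      refine Submodule.span_le.mpr ?_
      rintro _ ⟨i, rfl⟩
      exact hvmem J _ (by omega) (by omega)
    have h1 : Module.finrank ℂ (Submodule.span ℂ (Set.range fun i : Fin m => v (J - m + 1 + i))) = m := by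
      rw [finrank_span_eq_card hli, Fintype.card_fin]
    have h2 := Submodule.finrank_mono hsub
    rw [h1] at h2
    exact_mod_cast h2
  exact hcard.trans (le_algMultiplicity_of_le_jointGenEigenspace (piMinus ℚ μ) (normChar ℚ s) W hinv hle)

end LowerBound


/-! ## Part 2: the key lemma -/


/-! ### Mellin facts for Schwartz functions -/

section SchwartzMellin

variable (k : SchwartzMap ℝ ℂ)

/-- `∫₀^∞ k' = -k(0)` for a Schwartz function. [folklore] -/
theorem integral_Ioi_deriv_schwartz : ∫ t in Ioi (0 : ℝ), deriv (fun t : ℝ => k t) t = -k 0 := by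
  have hderiv : ∀ x ∈ Ici (0 : ℝ), HasDerivAt (fun t : ℝ => k t) (deriv (fun t : ℝ => k t) x) x :=
    fun x _ => k.differentiable.differentiableAt.hasDerivAt
  have hint : IntegrableOn (fun t : ℝ => deriv (fun t : ℝ => k t) t) (Ioi 0) := by
    have := ((SchwartzMap.derivCLM ℝ ℂ k).integrable (μ := volume)).integrableOn (s := Ioi (0 : ℝ))
    exact IntegrableOn.congr_fun this (fun t _ => by simp [SchwartzMap.derivCLM_apply]) measurableSet_Ioi
  have hlim : Tendsto (fun t : ℝ => k t) atTop (𝓝 0) := by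
    have h := (schwartz_isBigO_atTop_rpow_neg k 1).trans_tendsto (tendsto_rpow_neg_atTop one_pos)
    exact h
  rw [integral_Ioi_of_hasDerivAt_of_tendsto' hderiv hint hlim, zero_sub]

/-- `σ Mk(σ) = -M(k')(σ + 1)` for `σ > 0`. [folklore] -/
theorem mul_mellin_eq_neg_mellin_deriv {σ : ℂ} (hσ : 0 < σ.re) :
    σ * mellin (fun t : ℝ => k t) σ = -mellin (fun t : ℝ => deriv (fun t : ℝ => k t) t) (σ + 1) := by
  have h := mellin_scaledDeriv k (z := σ + 1) (by simp; linarith)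
  rw [add_sub_cancel_right] at h
  have he : (Real.exp 1 : ℂ) ≠ 0 := Complex.ofReal_ne_zero.mpr (Real.exp_pos 1).ne'
  have h2 : mellin (fun t : ℝ => scaledDeriv k t) (σ + 1) = (Real.exp 1 : ℂ) * mellin (fun t : ℝ => deriv (fun t : ℝ => k t) t) (σ + 1) := by
    rw [mellin, mellin, ← integral_const_mul]
    refine setIntegral_congr_fun measurableSet_Ioi fun t _ => ?_
    rw [scaledDeriv_apply, smul_eq_mul, smul_eq_mul]; ring
  rw [h2] at h
  have h3 : (Real.exp 1 : ℂ) * mellin (fun t : ℝ => deriv (fun t : ℝ => k t) t) (σ + 1) =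
      (Real.exp 1 : ℂ) * (-(σ * mellin (fun t : ℝ => k t) σ)) := by rw [h]; ring
  have := mul_left_cancel₀ he h3
  linear_combination this

/-- **The residue of `Mk` at `0` is `k(0)`**: `σ Mk(σ) → k(0)` as `σ → 0⁺` along the reals. [folklore] -/
theorem tendsto_mul_mellin_schwartz :
    Tendsto (fun σ : ℝ => (σ : ℂ) * mellin (fun t : ℝ => k t) σ) (𝓝[>] 0) (𝓝 (k 0)) := by
  have hcont : ContinuousAt (fun z : ℂ => mellin (fun t : ℝ => deriv (fun t : ℝ => k t) t) z) 1 := by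
    have h := differentiableAt_mellin_schwartz (SchwartzMap.derivCLM ℝ ℂ k) (z := 1) (by simp)
    have hfun : (fun t : ℝ => (SchwartzMap.derivCLM ℝ ℂ k) t) = fun t : ℝ => deriv (fun t : ℝ => k t) t := by
      funext t; simp [SchwartzMap.derivCLM_apply]
    rw [hfun] at h
    exact h.continuousAt
  have hval : mellin (fun t : ℝ => deriv (fun t : ℝ => k t) t) 1 = -k 0 := by
    rw [mellin, ← integral_Ioi_deriv_schwartz k]
    refine setIntegral_congr_fun measurableSet_Ioi fun t _ => ?_
    simp
  -- `σ Mk(σ) = -M(k')(σ+1) → -M(k')(1) = k(0)`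
  have hlim : Tendsto (fun σ : ℝ => -mellin (fun t : ℝ => deriv (fun t : ℝ => k t) t) ((σ : ℂ) + 1)) (𝓝[>] 0) (𝓝 (k 0)) := by
    have h1 : Tendsto (fun σ : ℝ => (σ : ℂ) + 1) (𝓝[>] (0 : ℝ)) (𝓝 1) := by
      have : Tendsto (fun σ : ℝ => (σ : ℂ) + 1) (𝓝 (0 : ℝ)) (𝓝 ((0 : ℝ) + 1 : ℂ)) :=
        (Complex.continuous_ofReal.tendsto 0).add tendsto_const_nhds
      simp at this
      exact this.mono_left nhdsWithin_le_nhds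
    have h2 := (hcont.tendsto.comp h1).neg
    rw [hval, neg_neg] at h2
    exact h2
  refine hlim.congr' ?_
  filter_upwards [self_mem_nhdsWithin] with σ hσ
  rw [mul_mellin_eq_neg_mellin_deriv k (by simpa using hσ)]

/-- For an even Schwartz function, `∫ k = 2 Mk(1)`. [folklore] -/
theorem integral_eq_two_mul_mellin_one (heven : ∀ t, k (-t) = k t) :
    ∫ t : ℝ, k t = 2 * mellin (fun t : ℝ => k t) 1 := by
  have hint : Integrable (fun t : ℝ => k t) := k.integrable
  have hsplit : ∫ t : ℝ, k t = (∫ t in Iic (0 : ℝ), k t) + ∫ t in Ioi (0 : ℝ), k t := by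
    rw [← setIntegral_union (Iic_disjoint_Ioi le_rfl) measurableSet_Ioi hint.integrableOn hint.integrableOn,
      Iic_union_Ioi, setIntegral_univ]
  have hneg : ∫ t in Iic (0 : ℝ), k t = ∫ t in Ioi (0 : ℝ), k t := by
    rw [← neg_zero, ← integral_comp_neg_Ioi]
    simp only [neg_zero, heven]
  have hmel : mellin (fun t : ℝ => k t) 1 = ∫ t in Ioi (0 : ℝ), k t := by
    rw [mellin]
    refine setIntegral_congr_fun measurableSet_Ioi fun t _ => ?_
    rw [sub_self, cpow_zero, one_smul]
  rw [hsplit, hneg, hmel]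
  ring

/-- **`𝓜(Σ(k ⊗ 1_Ẑ))(z) = 2 ζ(z) Mk(z)`** (`Re z > 1`) for an even Schwartz function `k`.
[cite: Meyer2005, §5.7] -/
theorem mellin_meyerSum_ratTensor_schwartz (heven : ∀ t, k (-t) = k t) {z : ℂ} (hz : 1 < z.re) :
    mellin (fun t : ℝ => meyerSum ℚ (ratTensor k) (posClass (Real.log t))) z = 2 * riemannZeta z * mellin (fun t : ℝ => k t) z := by
  rw [← mellin_tsum_int_ite k heven hz, mellin, mellin]
  refine setIntegral_congr_fun measurableSet_Ioi fun t ht => ?_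
  rw [meyerSum_ratTensor_eq, classNorm_posClass, Real.exp_log ht]

end SchwartzMellin

/-! ### `zetaTwo 1 = -1` and order of `e^z - e^s` at `s` -/

/-- `zetaTwo 1 = -1`. [folklore] -/
theorem zetaTwo_one : zetaTwo 1 = -1 := by
  rw [zetaTwo, zetaEntire, Gammaℝ_one]
  norm_num

/-- `ord_s (e^{az} - e^{as}) = 1` for real `a ≠ 0`. [folklore] -/
theorem analyticOrderAt_exp_sub_exp {a : ℝ} (ha : a ≠ 0) (s : ℂ) :
    analyticOrderAt (fun z : ℂ => cexp (a * z) - cexp (a * s)) s = 1 := by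
  rw [show (1 : ℕ∞) = ((1 : ℕ) : ℕ∞) from Nat.cast_one.symm, AnalyticAt.analyticOrderAt_eq_natCast (by fun_prop)]
  refine ⟨expSlope a s 0, (differentiable_expSlope a s 0).analyticAt s, ?_, Eventually.of_forall fun z => ?_⟩
  · rw [expSlope, dslope_same]
    have : deriv (fun z : ℂ => cexp (a * z)) s = cexp (a * s) * a := by
      have h := ((hasDerivAt_id s).const_mul (a : ℂ)).cexp
      simpa using h.deriv
    rw [this]
    exact mul_ne_zero (Complex.exp_ne_zero _) (Complex.ofReal_ne_zero.mpr ha)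
  · rw [pow_one, smul_eq_mul, exp_sub_exp_eq]

/-- Identity theorem from a right half plane `Re z > R` (`R ≥ 1`) to `Re z > 0`. [folklore] -/
theorem eqOn_of_eqOn_lt_re {A B : ℂ → ℂ} (R : ℝ) (hR : 1 ≤ R) (hA : DifferentiableOn ℂ A {z : ℂ | 0 < z.re})
    (hB : DifferentiableOn ℂ B {z : ℂ | 0 < z.re}) (h : ∀ z : ℂ, R < z.re → A z = B z) :
    EqOn A B {z : ℂ | 0 < z.re} := by
  have hopen : IsOpen {z : ℂ | 0 < z.re} := isOpen_lt continuous_const Complex.continuous_re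
  have hconv : Convex ℝ {z : ℂ | 0 < z.re} := convex_halfSpace_re_gt 0
  have hA' : AnalyticOnNhd ℂ A {z : ℂ | 0 < z.re} := hA.analyticOnNhd hopen
  have hB' : AnalyticOnNhd ℂ B {z : ℂ | 0 < z.re} := hB.analyticOnNhd hopen
  have hmem : ((R + 1 : ℝ) : ℂ) ∈ {z : ℂ | 0 < z.re} := by simp; linarith
  have hev : A =ᶠ[𝓝 ((R + 1 : ℝ) : ℂ)] B := by
    have hopen1 : IsOpen {z : ℂ | R < z.re} := isOpen_lt continuous_const Complex.continuous_re
    filter_upwards [hopen1.mem_nhds (show ((R + 1 : ℝ) : ℂ) ∈ {z : ℂ | R < z.re} by simp)] with w hw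
    exact h w hw
  exact hA'.eqOn_of_preconnected_of_eventuallyEq hB' hconv.isPreconnected hmem hev

/-- An entire function vanishing on a right half plane vanishes identically. [folklore] -/
theorem eq_zero_of_differentiable_of_eqOn_lt_re {F : ℂ → ℂ} (hF : Differentiable ℂ F) (R : ℝ)
    (h : ∀ z : ℂ, R < z.re → F z = 0) (z : ℂ) : F z = 0 := by
  have hana : AnalyticOnNhd ℂ F univ := hF.differentiableOn.analyticOnNhd isOpen_univ
  have hev : F =ᶠ[𝓝 ((R + 1 : ℝ) : ℂ)] 0 := by
    have hopen : IsOpen {z : ℂ | R < z.re} := isOpen_lt continuous_const Complex.continuous_re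
    filter_upwards [hopen.mem_nhds (show ((R + 1 : ℝ) : ℂ) ∈ {z : ℂ | R < z.re} by simp)] with w hw
    exact h w hw
  exact hana.eqOn_zero_of_preconnected_of_eventuallyEq_zero isPreconnected_univ (mem_univ _) hev (mem_univ z)

/-! ### The key lemma -/

section Key

variable [MeasurableSpace (AdeleRing (𝓞 ℚ) ℚ)] [BorelSpace (AdeleRing (𝓞 ℚ) ℚ)]
  (μ : Measure (AdeleRing (𝓞 ℚ) ℚ)) [μ.IsAddHaarMeasure]

/-- **The eigen-equation in Mellin terms.** If `[i₋ f]` is an eigenvector of `π₋(z(e^a))` with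
eigenvalue `e^{as}`, then `(e^{az} - e^{as}) f̂(z) = ζ(z) Mκ(z)` on `Re z > 1` for an even Schwartz `κ`.
[cite: Meyer2005, Thm. 5.11] -/
theorem exists_schwartz_of_eigen (f : ↥(Hminus ℚ))
    (hunr : ∀ u ∈ integralFiniteUnits ℚ, ∀ x, (f : IdeleClassGroup ℚ → ℂ) (x * finiteUnitClass ℚ u) = (f : IdeleClassGroup ℚ → ℂ) x)
    (s : ℂ) (a : ℝ)
    (heig : piMinus ℚ μ (posClass a) (toHzero μ f) = cexp (a * s) • toHzero μ f) :
    ∃ κ : SchwartzMap ℝ ℂ, (∀ t, κ (-t) = κ t) ∧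
      ∀ z : ℂ, 1 < z.re → (cexp (a * z) - cexp (a * s)) * mellin (fun t : ℝ => (f : IdeleClassGroup ℚ → ℂ) (posClass (Real.log t))) z =
        riemannZeta z * mellin (fun t : ℝ => κ t) z := by
  -- the defect `D = λ_g f - e^{as} f` has class `0`
  set g : IdeleClassGroup ℚ := posClass a with hg
  set D : ↥(Hminus ℚ) := ⟨classTranslate ℚ g f, classTranslate_mem_ideleClassSchwartzWeighted f.2 g⟩ - cexp (a * s) • f with hD
  have hD0 : toHzero μ D = 0 := by
    rw [hD, map_sub, map_smul, ← piMinus_toHzero, heig, sub_self]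
  have hDplus := iMinus_mem_Hplus_of_toHzero_eq_zero μ hD0
  have hDfun : (D : IdeleClassGroup ℚ → ℂ) = classTranslate ℚ g f - cexp (a * s) • (f : IdeleClassGroup ℚ → ℂ) := by
    rw [hD]; rfl
  have hDunr : ∀ u ∈ integralFiniteUnits ℚ, ∀ x, (D : IdeleClassGroup ℚ → ℂ) (x * finiteUnitClass ℚ u) = (D : IdeleClassGroup ℚ → ℂ) x := by
    intro u hu x
    rw [hDfun]
    simp only [Pi.sub_apply, Pi.smul_apply, classTranslate_unramified hunr g u hu x, hunr u hu x]
  obtain ⟨F, hF, hDF⟩ := (mem_Hplus_iff (μ := μ)).mp hDplus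
  have hDsum : (D : IdeleClassGroup ℚ → ℂ) = meyerSum ℚ F := by
    have := congrArg Prod.fst hDF
    rw [iMinus_apply] at this
    exact this
  have hSunr : ∀ u ∈ integralFiniteUnits ℚ, ∀ x, meyerSum ℚ F (x * finiteUnitClass ℚ u) = meyerSum ℚ F x := by
    rw [← hDsum]; exact hDunr
  obtain ⟨κ, hκeven, hκ⟩ := exists_schwartz_mellin_meyerSum hF hSunr
  refine ⟨κ, hκeven, fun z hz => ?_⟩
  rw [← hκ z hz, ← hDsum, hDfun]
  -- Mellin of `λ_g f - c f`
  have h1 := mellin_sub_of_mem_Hminus (classTranslate_unramified hunr g) (classTranslate_mem_ideleClassSchwartzWeighted f.2 g)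
    (f := classTranslate ℚ g f) (g := cexp (a * s) • (f : IdeleClassGroup ℚ → ℂ))
    (fun u hu x => by simp only [Pi.smul_apply, hunr u hu x]) (Submodule.smul_mem _ _ f.2) z
  rw [h1, mellin_classTranslate_eq hunr g z, ofReal_classNorm_cpow, hg, classNorm_posClass, Real.log_exp]
  have h2 : mellin (fun t : ℝ => (cexp (a * s) • (f : IdeleClassGroup ℚ → ℂ)) (posClass (Real.log t))) z =
      cexp (a * s) * mellin (fun t : ℝ => (f : IdeleClassGroup ℚ → ℂ) (posClass (Real.log t))) z := by
    rw [mellin, mellin, ← integral_const_mul]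
    refine setIntegral_congr_fun measurableSet_Ioi fun t _ => ?_
    simp only [Pi.smul_apply, smul_eq_mul]; ring
  rw [h2]
  ring

/-- **THE ANALYTIC CORE OF THE KEY LEMMA.** Let `f ∈ H₋` be unramified with
`(e^{az} - e^{as}) f̂(z) = ζ(z) Mκ_a(z)` (`Re z > 1`) for `a = 1` and `a = √2`, with even Schwartz
`κ_1`, where `Re s > 0` and either `s = 1`, or `Re s < 1 ∧ ord_s Λ ≤ ord_s f̂`, or `Re s ≥ 1, s ≠ 1`.
Then `f = Σ(k ⊗ 1_Ẑ)` for an even Schwartz `k` with `k(0) = 0 = ∫ k`. [cite: Meyer2005, Lemma 5.10, Thm. 5.11] -/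
theorem exists_theta_of_mellin_identities (hμ : μ (adeleFundamentalDomain ℚ) = 1) (f : ↥(Hminus ℚ))
    (hunr : ∀ u ∈ integralFiniteUnits ℚ, ∀ x, (f : IdeleClassGroup ℚ → ℂ) (x * finiteUnitClass ℚ u) = (f : IdeleClassGroup ℚ → ℂ) x)
    {s : ℂ} (hs0 : 0 < s.re) (κ₁ κ₂ : SchwartzMap ℝ ℂ) (hκ₁e : ∀ t, κ₁ (-t) = κ₁ t)
    (hκ₁ : ∀ z : ℂ, 1 < z.re → (cexp z - cexp s) * mellin (fun t : ℝ => (f : IdeleClassGroup ℚ → ℂ) (posClass (Real.log t))) z =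
      riemannZeta z * mellin (fun t : ℝ => κ₁ t) z)
    (hκ₂ : ∀ z : ℂ, 1 < z.re → (cexp (Real.sqrt 2 * z) - cexp (Real.sqrt 2 * s)) * mellin (fun t : ℝ => (f : IdeleClassGroup ℚ → ℂ) (posClass (Real.log t))) z =
      riemannZeta z * mellin (fun t : ℝ => κ₂ t) z)
    (hcase : s = 1 ∨ (s.re < 1 ∧ analyticOrderAt completedRiemannZeta s ≤
      analyticOrderAt (mellin (fun t : ℝ => (f : IdeleClassGroup ℚ → ℂ) (posClass (Real.log t)))) s) ∨ (1 ≤ s.re ∧ s ≠ 1)) :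
    ∃ k : SchwartzMap ℝ ℂ, (∀ t, k (-t) = k t) ∧ k 0 = 0 ∧ (∫ t : ℝ, k t) = 0 ∧
      (f : IdeleClassGroup ℚ → ℂ) = meyerSum ℚ (ratTensor k) := by
  set Φ : ℂ → ℂ := mellin (fun t : ℝ => (f : IdeleClassGroup ℚ → ℂ) (posClass (Real.log t))) with hΦ
  have hΦent : Differentiable ℂ Φ := differentiable_mellin_of_mem_Hminus hunr f.2
  -- normalised identities on `Re z > 0`
  have hopen : IsOpen {z : ℂ | 0 < z.re} := isOpen_lt continuous_const Complex.continuous_re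
  have hident : ∀ (a : ℝ) (κ : SchwartzMap ℝ ℂ),
      (∀ z : ℂ, 1 < z.re → (cexp (a * z) - cexp (a * s)) * Φ z = riemannZeta z * mellin (fun t : ℝ => κ t) z) →
      EqOn (fun z : ℂ => z * (1 - z) * (cexp (a * z) - cexp (a * s)) * Φ z)
        (fun z : ℂ => zetaTwo z * mellin (fun t : ℝ => κ t) z) {z : ℂ | 0 < z.re} := by
    intro a κ h
    refine eqOn_of_eqOn_one_lt_re ?_ ?_ fun z hz => ?_
    · exact ((((differentiable_id.mul ((differentiable_const (1 : ℂ)).sub differentiable_id)).mul (by fun_prop)).mul hΦent).differentiableOn)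
    · exact differentiable_zetaTwo.differentiableOn.mul fun z hz => (differentiableAt_mellin_schwartz κ hz).differentiableWithinAt
    · have hz0 : z ≠ 0 := by rintro rfl; norm_num at hz
      have hz1 : z ≠ 1 := by rintro rfl; norm_num at hz
      simp only [mul_assoc, h z hz, zetaTwo_eq hz0 hz1]
  have hI₁' := hident 1 κ₁ (fun z hz => by simpa using hκ₁ z hz)
  have hI₁ : EqOn (fun z : ℂ => z * (1 - z) * (cexp z - cexp s) * Φ z)
      (fun z : ℂ => zetaTwo z * mellin (fun t : ℝ => κ₁ t) z) {z : ℂ | 0 < z.re} := by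
    intro z hz; have h := hI₁' hz; simpa using h
  have hI₂ := hident (Real.sqrt 2) κ₂ hκ₂
  -- the cross identity `(e^{bz} - e^{bs}) Mκ₁ = (e^{z} - e^{s}) Mκ₂` on `Re z > 0`
  set b : ℝ := Real.sqrt 2 with hb
  have hcross : EqOn (fun z : ℂ => (cexp (b * z) - cexp (b * s)) * mellin (fun t : ℝ => κ₁ t) z -
      (cexp z - cexp s) * mellin (fun t : ℝ => κ₂ t) z) 0 {z : ℂ | 0 < z.re} := by
    refine eqOn_of_eqOn_one_lt_re ?_ (differentiableOn_const 0) fun z hz => ?_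
    · refine DifferentiableOn.sub ?_ ?_
      · exact (Differentiable.differentiableOn (by fun_prop)).mul fun z hz => (differentiableAt_mellin_schwartz κ₁ hz).differentiableWithinAt
      · exact (Differentiable.differentiableOn (by fun_prop)).mul fun z hz => (differentiableAt_mellin_schwartz κ₂ hz).differentiableWithinAt
    · -- on `Re z > 1`: `zetaTwo z ≠ 0`, and `zetaTwo · cross = 0`
      have hz0 : z ≠ 0 := by rintro rfl; norm_num at hz
      have hz1 : z ≠ 1 := by rintro rfl; norm_num at hz
      have hζ : zetaTwo z ≠ 0 := by
        rw [zetaTwo_eq hz0 hz1]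
        exact mul_ne_zero (mul_ne_zero hz0 (sub_ne_zero.mpr (Ne.symm hz1))) (riemannZeta_ne_zero_of_one_lt_re hz)
      have h1 := hI₁ (show z ∈ {z : ℂ | 0 < z.re} by simp; linarith)
      have h2 := hI₂ (show z ∈ {z : ℂ | 0 < z.re} by simp; linarith)
      simp only at h1 h2
      apply mul_left_cancel₀ hζ
      simp only [Pi.zero_apply, mul_zero]
      have := congrArg₂ (fun x y => x * (cexp (b * z) - cexp (b * s)) - y * (cexp z - cexp s)) h1 h2
      linear_combination -this
  -- vanishing of `Mκ₁(s + 2πik)` for all `k`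
  have hvan : ∀ k : ℤ, mellin (fun t : ℝ => κ₁ t) (s + 2 * π * k * I) = 0 := by
    intro k
    rcases eq_or_ne k 0 with rfl | hk
    · simp only [Int.cast_zero, mul_zero, zero_mul, add_zero]
      rcases hcase with rfl | ⟨hs1, hord⟩ | ⟨hs1, hne1⟩
      · -- `s = 1`: evaluate the identity at `z = 1`
        have h := hI₁ (show (1 : ℂ) ∈ {z : ℂ | 0 < z.re} by simp)
        simp only [sub_self, mul_zero, zero_mul, zetaTwo_one] at h
        linear_combination h
      rotate_left
      · -- `Re s ≥ 1`, `s ≠ 1`: evaluate at `z = s`, where `zetaTwo s ≠ 0`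
        have h := hI₁ (show s ∈ {z : ℂ | 0 < z.re} from hs0)
        simp only [sub_self, mul_zero, zero_mul] at h
        have h0 : s ≠ 0 := by rintro rfl; simp at hs0
        have hζ : zetaTwo s ≠ 0 := by
          rw [zetaTwo_eq h0 hne1]
          exact mul_ne_zero (mul_ne_zero h0 (sub_ne_zero.mpr (Ne.symm hne1))) (riemannZeta_ne_zero_of_one_le_re hs1)
        exact (mul_eq_zero.mp h.symm).resolve_left hζ
      · -- `Re s < 1`: compare orders at `s`
        have hsmem : s ∈ {z : ℂ | 0 < z.re} := hs0
        have h0 : s ≠ 0 := by rintro rfl; simp at hs0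
        have h1 : s ≠ 1 := by rintro rfl; simp at hs1
        have hev : (fun z : ℂ => z * (1 - z) * (cexp z - cexp s) * Φ z) =ᶠ[𝓝 s]
            fun z : ℂ => zetaTwo z * mellin (fun t : ℝ => κ₁ t) z := by
          filter_upwards [hopen.mem_nhds hsmem] with z hz using hI₁ hz
        have hordL : analyticOrderAt (fun z : ℂ => z * (1 - z) * (cexp z - cexp s) * Φ z) s =
            1 + analyticOrderAt Φ s := by
          rw [show (fun z : ℂ => z * (1 - z) * (cexp z - cexp s) * Φ z) =
              ((fun z : ℂ => z * (1 - z)) * fun z : ℂ => cexp ((1 : ℝ) * z) - cexp ((1 : ℝ) * s)) * Φ by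
                funext z; simp [Pi.mul_apply],
            analyticOrderAt_mul (by fun_prop) (hΦent.analyticAt s), analyticOrderAt_mul (by fun_prop) (by fun_prop),
            analyticOrderAt_mul_one_sub h0 h1, analyticOrderAt_exp_sub_exp one_ne_zero, zero_add]
        have hκan : AnalyticAt ℂ (mellin (fun t : ℝ => κ₁ t)) s :=
          Complex.analyticAt_iff_eventually_differentiableAt.mpr (by
            filter_upwards [hopen.mem_nhds hsmem] with z hz using differentiableAt_mellin_schwartz κ₁ hz)
        have hordR : analyticOrderAt (fun z : ℂ => zetaTwo z * mellin (fun t : ℝ => κ₁ t) z) s =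
            analyticOrderAt completedRiemannZeta s + analyticOrderAt (mellin (fun t : ℝ => κ₁ t)) s := by
          rw [show (fun z : ℂ => zetaTwo z * mellin (fun t : ℝ => κ₁ t) z) = zetaTwo * mellin (fun t : ℝ => κ₁ t) from rfl,
            analyticOrderAt_mul (differentiable_zetaTwo.analyticAt s) hκan, analyticOrderAt_zetaTwo hs0 h1]
        have heq : 1 + analyticOrderAt Φ s = analyticOrderAt completedRiemannZeta s + analyticOrderAt (mellin (fun t : ℝ => κ₁ t)) s := by
          rw [← hordL, ← hordR, analyticOrderAt_congr hev]
        -- `ord Λ` is finite (it is at most `ord Φ`... we use the finiteness from `ZetaOrders`)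
        have hΛfin : analyticOrderAt completedRiemannZeta s ≠ ⊤ := by
          intro htop
          have h2 : analyticOrderAt zetaEntire s = ⊤ := by rw [analyticOrderAt_zetaEntire h0 h1, htop]
          rw [analyticOrderAt_eq_top] at h2
          have hana : AnalyticOnNhd ℂ zetaEntire univ := differentiable_zetaEntire.differentiableOn.analyticOnNhd isOpen_univ
          have h := hana.eqOn_zero_of_preconnected_of_eventuallyEq_zero isPreconnected_univ (mem_univ s) h2 (mem_univ 2)
          have h2' : zetaEntire 2 = 2 * (1 - 2) * completedRiemannZeta 2 := zetaEntire_eq two_ne_zero (by norm_num)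
          rw [h2'] at h
          exact completedZeta_ne_zero_of_not_mem_strip two_ne_zero (by norm_num) (Or.inr (by norm_num)) (by have h' := h; norm_num at h'; exact h')
        obtain ⟨m, hm⟩ := ENat.ne_top_iff_exists.mp hΛfin
        have hpos : analyticOrderAt (mellin (fun t : ℝ => κ₁ t)) s ≠ 0 := by
          intro h0'
          rw [h0', add_zero, ← hm] at heq
          rw [← hm] at hord
          -- `1 + ord Φ = m ≤ ord Φ`: impossible for finite values; if `ord Φ = ⊤` then `m = ⊤`, absurd
          induction hx : analyticOrderAt Φ s using ENat.recTopCoe with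
          | top => rw [hx] at heq; exact absurd heq.symm (by simp)
          | coe n =>
            rw [hx] at heq hord
            have h1' : ((1 + n : ℕ) : ℕ∞) = (m : ℕ∞) := by simpa using heq
            have := ENat.coe_inj.mp h1'
            have := ENat.coe_le_coe.mp hord
            omega
        exact apply_eq_zero_of_analyticOrderAt_ne_zero hκan hpos
    · -- `k ≠ 0`: use the cross identity at `z_k = s + 2πik`
      set zk : ℂ := s + 2 * π * k * I with hzk
      have hzkmem : zk ∈ {z : ℂ | 0 < z.re} := by simp [hzk]; exact hs0
      have h := hcross hzkmem
      simp only [Pi.zero_apply] at h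
      have he1 : cexp zk - cexp s = 0 := by
        rw [hzk, show s + 2 * π * k * I = s + k * (2 * π * I) by ring, Complex.exp_add,
          Complex.exp_int_mul_two_pi_mul_I, mul_one, sub_self]
      rw [he1, zero_mul, sub_zero, mul_eq_zero] at h
      rcases h with h | h
      · exfalso
        -- `e^{b z_k} = e^{b s}` would force `b k ∈ ℤ`, contradicting the irrationality of `√2`
        have hexp : cexp (b * (2 * π * k * I)) = 1 := by
          have h' : cexp (b * zk) = cexp (b * s) := sub_eq_zero.mp h
          rw [hzk, mul_add, Complex.exp_add] at h'
          have hne : cexp (b * s) ≠ 0 := Complex.exp_ne_zero _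
          have := mul_left_cancel₀ hne (h'.trans (mul_one _).symm)
          exact this
        obtain ⟨n, hn⟩ := Complex.exp_eq_one_iff.mp hexp
        have h2pi : (2 * (π : ℂ) * I) ≠ 0 := by simp [Real.pi_ne_zero, Complex.I_ne_zero]
        have hbk : (b : ℂ) * k = n := by
          have h3 : ((b : ℂ) * k - n) * (2 * π * I) = 0 := by linear_combination hn
          rcases mul_eq_zero.mp h3 with h3 | h3
          · exact sub_eq_zero.mp h3
          · exact absurd h3 h2pi
        have hbk' : b * (k : ℝ) = (n : ℝ) := by exact_mod_cast hbk
        have hk0 : (k : ℝ) ≠ 0 := by exact_mod_cast hk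
        have hsqrt : Real.sqrt 2 = (n : ℝ) / (k : ℝ) := by rw [← hb, eq_div_iff hk0, hbk']
        exact irrational_sqrt_two ⟨(n : ℚ) / (k : ℚ), by rw [hsqrt]; push_cast; ring⟩
      · exact h
  /- solve the twisted difference equation and identify `f` with a theta vector -/
  obtain ⟨kf, hkfeven, hkfT, -⟩ := exists_schwartz_twistedDifference κ₁ (σ := 1) (fun t => by rw [one_mul]; exact hκ₁e t) hs0 hvan
  simp only [one_mul] at hkfeven
  -- `Mκ₁(z) = (e^{z} - e^{s}) M kf(z)` for `Re z > 0`
  have hMrel : ∀ z : ℂ, 0 < z.re → mellin (fun t : ℝ => κ₁ t) z = (cexp z - cexp s) * mellin (fun t : ℝ => kf t) z := by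
    intro z hz
    have hc : (0 : ℝ) < Real.exp (-1) := Real.exp_pos _
    have hconv1 : MellinConvergent (fun t : ℝ => kf (Real.exp (-1) * t)) z :=
      (MellinConvergent.comp_mul_left hc).mpr (mellinConvergent_schwartz kf hz)
    have hconv2 : MellinConvergent (fun t : ℝ => kf t) z := mellinConvergent_schwartz kf hz
    have hfun : (fun t : ℝ => κ₁ t) = fun t => kf (Real.exp (-1) * t) - cexp s • kf t := by
      funext t; rw [smul_eq_mul]; exact (hkfT t).symm
    have h1 := (hasMellin_sub hconv1 (hconv2.const_smul (cexp s))).2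
    have h2 : mellin (fun t : ℝ => cexp s • kf t) z = cexp s * mellin (fun t : ℝ => kf t) z := by
      rw [mellin_const_smul, smul_eq_mul]
    have h3 : mellin (fun t : ℝ => kf (Real.exp (-1) * t)) z = cexp z * mellin (fun t : ℝ => kf t) z := by
      rw [mellin_comp_mul_left (fun t : ℝ => kf t) z hc, smul_eq_mul, ofReal_exp_neg_cpow, Complex.ofReal_one, one_mul]
    rw [hfun, h1, h2, h3]
    ring
  -- hence `Φ = ζ · M kf` on `Re z > R := max 1 (Re s)` (where `e^z ≠ e^s`)
  set R : ℝ := max 1 s.re with hR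
  have hR1 : 1 ≤ R := le_max_left _ _
  have hΦζ : ∀ z : ℂ, R < z.re → Φ z = riemannZeta z * mellin (fun t : ℝ => kf t) z := by
    intro z hz
    have hz1 : 1 < z.re := lt_of_le_of_lt hR1 hz
    have h := hκ₁ z hz1
    rw [hMrel z (by linarith)] at h
    have hne : cexp z - cexp s ≠ 0 := by
      intro h0
      obtain ⟨n, hn⟩ := Complex.exp_eq_exp_iff_exists_int.mp (sub_eq_zero.mp h0)
      have := congrArg Complex.re hn
      simp at this
      have : s.re ≤ R := le_max_right _ _
      linarith
    apply mul_left_cancel₀ hne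
    linear_combination h
  -- the normalised identity `z(1-z) Φ = zetaTwo · M kf` on `Re z > 0`
  have hI : EqOn (fun z : ℂ => z * (1 - z) * Φ z) (fun z : ℂ => zetaTwo z * mellin (fun t : ℝ => kf t) z) {z : ℂ | 0 < z.re} := by
    refine eqOn_of_eqOn_lt_re R hR1 ?_ ?_ fun z hz => ?_
    · exact (((differentiable_id.mul ((differentiable_const (1 : ℂ)).sub differentiable_id)).mul hΦent).differentiableOn)
    · exact differentiable_zetaTwo.differentiableOn.mul fun z hz => (differentiableAt_mellin_schwartz kf hz).differentiableWithinAt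
    · have hz1' : 1 < z.re := lt_of_le_of_lt hR1 hz
      have hz0 : z ≠ 0 := by rintro rfl; norm_num at hz1'
      have hz1 : z ≠ 1 := by rintro rfl; norm_num at hz1'
      simp only [hΦζ z hz, zetaTwo_eq hz0 hz1]
      ring
  -- `M kf(1) = 0`, hence `∫ kf = 0`
  have hM1 : mellin (fun t : ℝ => kf t) 1 = 0 := by
    have h := hI (show (1 : ℂ) ∈ {z : ℂ | 0 < z.re} by simp)
    simp only [sub_self, mul_zero, zero_mul, zetaTwo_one] at h
    linear_combination h
  have hint : ∫ t : ℝ, kf t = 0 := by rw [integral_eq_two_mul_mellin_one kf hkfeven, hM1, mul_zero]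
  -- `kf(0) = 0` by the residue at `0`
  have hk0 : kf 0 = 0 := by
    have hres := tendsto_mul_mellin_schwartz kf
    -- along `σ → 0⁺`: `σ M kf(σ) · (1-σ) ζ(σ) = σ (1-σ) Φ(σ) → 0`
    have hζcont : ContinuousAt riemannZeta 0 := (differentiableAt_riemannZeta zero_ne_one).continuousAt
    have hlim1 : Tendsto (fun σ : ℝ => ((σ : ℂ) * mellin (fun t : ℝ => kf t) σ) * ((1 - (σ : ℂ)) * riemannZeta σ))
        (𝓝[>] 0) (𝓝 (kf 0 * ((1 - 0) * riemannZeta 0))) := by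
      refine hres.mul ?_
      have h1 : Tendsto (fun σ : ℝ => (σ : ℂ)) (𝓝[>] (0 : ℝ)) (𝓝 0) :=
        (Complex.continuous_ofReal.tendsto 0).mono_left nhdsWithin_le_nhds
      exact ((tendsto_const_nhds.sub h1).mul (hζcont.tendsto.comp h1))
    have hlim2 : Tendsto (fun σ : ℝ => ((σ : ℂ) * mellin (fun t : ℝ => kf t) σ) * ((1 - (σ : ℂ)) * riemannZeta σ))
        (𝓝[>] 0) (𝓝 0) := by
      have hΦc : Tendsto (fun σ : ℝ => (σ : ℂ) * ((1 - (σ : ℂ)) * Φ σ)) (𝓝[>] (0 : ℝ)) (𝓝 (0 * ((1 - 0) * Φ 0))) := by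
        have h1 : Tendsto (fun σ : ℝ => (σ : ℂ)) (𝓝[>] (0 : ℝ)) (𝓝 0) :=
          (Complex.continuous_ofReal.tendsto 0).mono_left nhdsWithin_le_nhds
        exact h1.mul ((tendsto_const_nhds.sub h1).mul (hΦent.continuous.continuousAt.tendsto.comp h1))
      rw [zero_mul] at hΦc
      refine hΦc.congr' ?_
      filter_upwards [Ioo_mem_nhdsGT (show (0 : ℝ) < 1 by norm_num)] with σ hσ
      have hσ0 : (σ : ℂ) ≠ 0 := Complex.ofReal_ne_zero.mpr hσ.1.ne'
      have hσ1 : (σ : ℂ) ≠ 1 := by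
        intro h; have := congrArg Complex.re h; simp at this; linarith [hσ.2]
      have h := hI (show (σ : ℂ) ∈ {z : ℂ | 0 < z.re} by simpa using hσ.1)
      simp only [zetaTwo_eq hσ0 hσ1] at h
      linear_combination h
    have := tendsto_nhds_unique hlim1 hlim2
    rw [sub_zero, one_mul, riemannZeta_zero, mul_eq_zero] at this
    rcases this with h | h
    · exact h
    · norm_num at h
  -- the theta vector `h = Σ((kf/2) ⊗ 1_Ẑ)`
  set k₂ : SchwartzMap ℝ ℂ := (1 / 2 : ℂ) • kf with hk₂
  have hk₂even : ∀ t, k₂ (-t) = k₂ t := fun t => by simp [hk₂, hkfeven t]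
  have hk₂0 : k₂ 0 = 0 := by simp [hk₂, hk0]
  have hk₂int : ∫ t : ℝ, k₂ t = 0 := by
    simp only [hk₂, smul_apply, smul_eq_mul]
    rw [integral_const_mul, hint, mul_zero]
  have hhmem : meyerSum ℚ (ratTensor k₂) ∈ Hminus ℚ := meyerSum_ratTensor_mem_Hminus (μ := μ) hμ k₂ hk₂0 hk₂int
  have hhunr : ∀ u ∈ integralFiniteUnits ℚ, ∀ x, meyerSum ℚ (ratTensor k₂) (x * finiteUnitClass ℚ u) = meyerSum ℚ (ratTensor k₂) x :=
    fun u hu x => meyerSum_ratTensor_mul_finiteUnitClass (⇑k₂) hu x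
  have hfeq : (f : IdeleClassGroup ℚ → ℂ) = meyerSum ℚ (ratTensor k₂) := by
    -- the two (entire) Mellin transforms agree on `Re z > R`, hence on `Re z > 1`
    have hdiff : Differentiable ℂ (fun z => Φ z - mellin (fun t : ℝ => meyerSum ℚ (ratTensor k₂) (posClass (Real.log t))) z) :=
      hΦent.sub (differentiable_mellin_of_mem_Hminus hhunr hhmem)
    have hzero := eq_zero_of_differentiable_of_eqOn_lt_re hdiff R fun z hz => by
      have hz1 : 1 < z.re := lt_of_le_of_lt hR1 hz
      rw [mellin_meyerSum_ratTensor_schwartz k₂ hk₂even hz1, hΦζ z hz]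
      have : mellin (fun t : ℝ => k₂ t) z = (1 / 2 : ℂ) * mellin (fun t : ℝ => kf t) z := by
        rw [mellin, mellin, ← integral_const_mul]
        refine setIntegral_congr_fun measurableSet_Ioi fun t _ => ?_
        simp only [hk₂, smul_apply, smul_eq_mul]; ring
      rw [this]
      ring
    refine eq_of_mellin_eqOn hunr f.2 hhunr hhmem fun z _ => sub_eq_zero.mp (hzero z)
  exact ⟨k₂, hk₂even, hk₂0, hk₂int, hfeq⟩

/-- **THE KEY LEMMA.** A joint eigenvector of `π₋` for `|x|^s` (`Re s > 0`), represented by an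
unramified `f ∈ H₋`, vanishes if either `s = 1`, or `Re s < 1` and `ord_s f̂ ≥ ord_s Λ`, or
`Re s ≥ 1`, `s ≠ 1`. [cite: Meyer2005, Thm. 5.11] -/
theorem toHzero_eq_zero_of_eigenvector (hμ : μ (adeleFundamentalDomain ℚ) = 1) (f : ↥(Hminus ℚ))
    (hunr : ∀ u ∈ integralFiniteUnits ℚ, ∀ x, (f : IdeleClassGroup ℚ → ℂ) (x * finiteUnitClass ℚ u) = (f : IdeleClassGroup ℚ → ℂ) x)
    {s : ℂ} (hs0 : 0 < s.re)
    (heig : ∀ g : IdeleClassGroup ℚ, piMinus ℚ μ g (toHzero μ f) = normChar ℚ s g • toHzero μ f)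
    (hcase : s = 1 ∨ (s.re < 1 ∧ analyticOrderAt completedRiemannZeta s ≤
      analyticOrderAt (mellin (fun t : ℝ => (f : IdeleClassGroup ℚ → ℂ) (posClass (Real.log t)))) s) ∨ (1 ≤ s.re ∧ s ≠ 1)) :
    toHzero μ f = 0 := by
  -- eigen-equations for `a = 1` and `a = √2`
  have heig' : ∀ a : ℝ, piMinus ℚ μ (posClass a) (toHzero μ f) = cexp (a * s) • toHzero μ f := by
    intro a
    rw [heig, normChar_eq_exp, classNorm_posClass, Real.log_exp]
  obtain ⟨κ₁, hκ₁e, hκ₁⟩ := exists_schwartz_of_eigen μ f hunr s 1 (heig' 1)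
  obtain ⟨κ₂, -, hκ₂⟩ := exists_schwartz_of_eigen μ f hunr s (Real.sqrt 2) (heig' (Real.sqrt 2))
  obtain ⟨k₂, -, hk₂0, hk₂int, hfeq⟩ :=
    exists_theta_of_mellin_identities μ hμ f hunr hs0 κ₁ κ₂ hκ₁e (fun z hz => by simpa using hκ₁ z hz) hκ₂ hcase
  have hhmem : meyerSum ℚ (ratTensor k₂) ∈ Hminus ℚ := meyerSum_ratTensor_mem_Hminus (μ := μ) hμ k₂ hk₂0 hk₂int
  have hhplus : iMinus ℚ (meyerSum ℚ (ratTensor k₂)) ∈ Hplus ℚ μ := iMinus_meyerSum_ratTensor_mem_Hplus μ hμ k₂ hk₂0 hk₂int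
  have hfsub : f = ⟨meyerSum ℚ (ratTensor k₂), hhmem⟩ := Subtype.ext hfeq
  rw [hfsub]
  exact toHzero_eq_zero μ hhplus

end Key


/-! ## Part 3: the upper bound -/

section UpperBoundPart


/-- `ord_s Λ` is finite for `s ∉ {0, 1}`. [folklore] -/
theorem analyticOrderAt_completedZeta_ne_top {s : ℂ} (h0 : s ≠ 0) (h1 : s ≠ 1) :
    analyticOrderAt completedRiemannZeta s ≠ ⊤ := by
  intro htop
  have h2 : analyticOrderAt zetaEntire s = ⊤ := by rw [analyticOrderAt_zetaEntire h0 h1, htop]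
  rw [analyticOrderAt_eq_top] at h2
  have hana : AnalyticOnNhd ℂ zetaEntire univ := differentiable_zetaEntire.differentiableOn.analyticOnNhd isOpen_univ
  have h := hana.eqOn_zero_of_preconnected_of_eventuallyEq_zero isPreconnected_univ (mem_univ s) h2 (mem_univ 2)
  have h2' : zetaEntire 2 = 2 * (1 - 2) * completedRiemannZeta 2 := zetaEntire_eq two_ne_zero (by norm_num)
  rw [h2'] at h
  exact completedZeta_ne_zero_of_not_mem_strip two_ne_zero (by norm_num) (Or.inr (by norm_num)) (by have h' := h; norm_num at h'; exact h')

variable [MeasurableSpace (AdeleRing (𝓞 ℚ) ℚ)] [BorelSpace (AdeleRing (𝓞 ℚ) ℚ)]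
  (μ : Measure (AdeleRing (𝓞 ℚ) ℚ)) [μ.IsAddHaarMeasure]

/-! ### Chosen unramified representatives and jets -/

section Jets

/-- A chosen unramified representative in `H₋` of a `𝒪̂ˣ`-fixed class of `H⁰₋`. [cite: Meyer2005, §5.1] -/
def urep (v : HzeroMinus ℚ μ) (hv : ∀ u ∈ integralFiniteUnits ℚ, piMinus ℚ μ (finiteUnitClass ℚ u) v = v) : ↥(Hminus ℚ) :=
  ⟨Classical.choose (exists_unramified_rep μ v hv), (Classical.choose_spec (exists_unramified_rep μ v hv)).1⟩

omit [BorelSpace (AdeleRing (𝓞 ℚ) ℚ)] [μ.IsAddHaarMeasure] in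
/-- The chosen representative is unramified. [folklore] -/
theorem urep_unramified (v : HzeroMinus ℚ μ) (hv : ∀ u ∈ integralFiniteUnits ℚ, piMinus ℚ μ (finiteUnitClass ℚ u) v = v) :
    ∀ u ∈ integralFiniteUnits ℚ, ∀ x, (urep μ v hv : IdeleClassGroup ℚ → ℂ) (x * finiteUnitClass ℚ u) = (urep μ v hv : IdeleClassGroup ℚ → ℂ) x :=
  (Classical.choose_spec (exists_unramified_rep μ v hv)).2.1

omit [BorelSpace (AdeleRing (𝓞 ℚ) ℚ)] [μ.IsAddHaarMeasure] in
/-- The chosen representative represents `v`. [folklore] -/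
theorem toHzero_urep (v : HzeroMinus ℚ μ) (hv : ∀ u ∈ integralFiniteUnits ℚ, piMinus ℚ μ (finiteUnitClass ℚ u) v = v) :
    toHzero μ (urep μ v hv) = v := by
  rw [toHzero_apply]
  exact ((Classical.choose_spec (exists_unramified_rep μ v hv)).2.2).symm

variable (s : ℂ) (m : ℕ)

/-- The jet `(∂ⁱ f̂ (s))_{i<m}` of the Fourier–Laplace transform of `f ∈ H₋`. [cite: Meyer2005, §2.3] -/
def jetOf (f : ↥(Hminus ℚ)) : Fin m → ℂ :=
  fun i => iteratedDeriv i (mellin (fun t : ℝ => (f : IdeleClassGroup ℚ → ℂ) (posClass (Real.log t)))) s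

variable {s m}

omit [MeasurableSpace (AdeleRing (𝓞 ℚ) ℚ)] [BorelSpace (AdeleRing (𝓞 ℚ) ℚ)] in
/-- Jets add (for unramified `f, g`, whose Mellin transforms are entire). [folklore] -/
theorem jetOf_add {f g : ↥(Hminus ℚ)}
    (hf : ∀ u ∈ integralFiniteUnits ℚ, ∀ x, (f : IdeleClassGroup ℚ → ℂ) (x * finiteUnitClass ℚ u) = (f : IdeleClassGroup ℚ → ℂ) x)
    (hg : ∀ u ∈ integralFiniteUnits ℚ, ∀ x, (g : IdeleClassGroup ℚ → ℂ) (x * finiteUnitClass ℚ u) = (g : IdeleClassGroup ℚ → ℂ) x) :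
    jetOf s m (f + g) = jetOf s m f + jetOf s m g := by
  funext i
  simp only [jetOf, Pi.add_apply]
  have hfg : ∀ u ∈ integralFiniteUnits ℚ, ∀ x, ((f + g : ↥(Hminus ℚ)) : IdeleClassGroup ℚ → ℂ) (x * finiteUnitClass ℚ u) =
      ((f + g : ↥(Hminus ℚ)) : IdeleClassGroup ℚ → ℂ) x := by
    intro u hu x; simp only [Submodule.coe_add, Pi.add_apply, hf u hu x, hg u hu x]
  have hfun : mellin (fun t : ℝ => ((f + g : ↥(Hminus ℚ)) : IdeleClassGroup ℚ → ℂ) (posClass (Real.log t))) =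
      mellin (fun t : ℝ => (f : IdeleClassGroup ℚ → ℂ) (posClass (Real.log t))) +
        mellin (fun t : ℝ => (g : IdeleClassGroup ℚ → ℂ) (posClass (Real.log t))) := by
    funext z
    rw [Pi.add_apply, mellin, mellin, mellin, ← integral_add (mellinConvergent_of_mem_Hminus hf f.2 z)
      (mellinConvergent_of_mem_Hminus hg g.2 z)]
    refine setIntegral_congr_fun measurableSet_Ioi fun t _ => ?_
    simp only [Submodule.coe_add, Pi.add_apply, smul_eq_mul, mul_add]
  rw [hfun, iteratedDeriv_add]
  · exact ((differentiable_mellin_of_mem_Hminus hf f.2).contDiff.of_le le_top).contDiffAt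
  · exact ((differentiable_mellin_of_mem_Hminus hg g.2).contDiff.of_le le_top).contDiffAt

omit [MeasurableSpace (AdeleRing (𝓞 ℚ) ℚ)] [BorelSpace (AdeleRing (𝓞 ℚ) ℚ)] in
/-- Jets are homogeneous. [folklore] -/
theorem jetOf_smul (c : ℂ) {f : ↥(Hminus ℚ)}
    (hf : ∀ u ∈ integralFiniteUnits ℚ, ∀ x, (f : IdeleClassGroup ℚ → ℂ) (x * finiteUnitClass ℚ u) = (f : IdeleClassGroup ℚ → ℂ) x) :
    jetOf s m (c • f) = c • jetOf s m f := by
  funext i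
  simp only [jetOf, Pi.smul_apply, smul_eq_mul]
  have hfun : mellin (fun t : ℝ => ((c • f : ↥(Hminus ℚ)) : IdeleClassGroup ℚ → ℂ) (posClass (Real.log t))) =
      fun z => c * mellin (fun t : ℝ => (f : IdeleClassGroup ℚ → ℂ) (posClass (Real.log t))) z := by
    funext z
    rw [mellin, mellin, ← integral_const_mul]
    refine setIntegral_congr_fun measurableSet_Ioi fun t _ => ?_
    simp only [Submodule.coe_smul, Pi.smul_apply, smul_eq_mul]; ring
  rw [hfun, iteratedDeriv_const_mul _ ((differentiable_mellin_of_mem_Hminus hf f.2).contDiff.of_le le_top).contDiffAt]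

/-- **Well-definedness of jets on classes** (`0 < Re s < 1`, `m ≤ ord_s Λ`): two unramified
representatives of the same class of `H⁰₋` have the same jet of length `m`, because their difference
is `Σ F` with `F ∈ 𝒮(𝔸_ℚ)`, whose Mellin transform is divisible by `ζ`. [cite: Meyer2005, Lemma 5.3] -/
theorem jetOf_eq_of_toHzero_eq (hs0 : 0 < s.re) (hs1 : s.re < 1) (hm : (m : ℕ∞) ≤ analyticOrderAt completedRiemannZeta s)
    {f g : ↥(Hminus ℚ)}
    (hf : ∀ u ∈ integralFiniteUnits ℚ, ∀ x, (f : IdeleClassGroup ℚ → ℂ) (x * finiteUnitClass ℚ u) = (f : IdeleClassGroup ℚ → ℂ) x)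
    (hg : ∀ u ∈ integralFiniteUnits ℚ, ∀ x, (g : IdeleClassGroup ℚ → ℂ) (x * finiteUnitClass ℚ u) = (g : IdeleClassGroup ℚ → ℂ) x)
    (h : toHzero μ f = toHzero μ g) : jetOf s m f = jetOf s m g := by
  -- `D = f - g` represents `0`
  have hD0 : toHzero μ (f - g) = 0 := by rw [map_sub, h, sub_self]
  have hDplus := iMinus_mem_Hplus_of_toHzero_eq_zero μ hD0
  have hDunr : ∀ u ∈ integralFiniteUnits ℚ, ∀ x, ((f - g : ↥(Hminus ℚ)) : IdeleClassGroup ℚ → ℂ) (x * finiteUnitClass ℚ u) =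
      ((f - g : ↥(Hminus ℚ)) : IdeleClassGroup ℚ → ℂ) x := by
    intro u hu x; simp only [Submodule.coe_sub, Pi.sub_apply, hf u hu x, hg u hu x]
  obtain ⟨F, hF, hDF⟩ := (mem_Hplus_iff (μ := μ)).mp hDplus
  have hDsum : ((f - g : ↥(Hminus ℚ)) : IdeleClassGroup ℚ → ℂ) = meyerSum ℚ F := by
    have := congrArg Prod.fst hDF
    rw [iMinus_apply] at this
    exact this
  have hSunr : ∀ u ∈ integralFiniteUnits ℚ, ∀ x, meyerSum ℚ F (x * finiteUnitClass ℚ u) = meyerSum ℚ F x := by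
    rw [← hDsum]; exact hDunr
  obtain ⟨Q, hQ, hMQ⟩ := exists_mellin_meyerSum_eq_zeta_mul hF hSunr
  have hMD : Differentiable ℂ (mellin (fun t : ℝ => ((f - g : ↥(Hminus ℚ)) : IdeleClassGroup ℚ → ℂ) (posClass (Real.log t)))) :=
    differentiable_mellin_of_mem_Hminus hDunr (f - g).2
  have hord : (m : ℕ∞) ≤ analyticOrderAt (mellin (fun t : ℝ => ((f - g : ↥(Hminus ℚ)) : IdeleClassGroup ℚ → ℂ) (posClass (Real.log t)))) s := by
    refine hm.trans (analyticOrderAt_ge_of_eq_zeta_mul hMD hQ (fun z hz => ?_) hs0 hs1)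
    rw [← hMQ z hz, hDsum]
  rw [natCast_le_analyticOrderAt_iff_iteratedDeriv_eq_zero (hMD.analyticAt s)] at hord
  -- `jet (f - g) = jet f - jet g = 0`
  have hsub : jetOf s m (f - g) = jetOf s m f - jetOf s m g := by
    have hneg : ∀ u ∈ integralFiniteUnits ℚ, ∀ x, ((-g : ↥(Hminus ℚ)) : IdeleClassGroup ℚ → ℂ) (x * finiteUnitClass ℚ u) =
        ((-g : ↥(Hminus ℚ)) : IdeleClassGroup ℚ → ℂ) x := by
      intro u hu x; simp only [Submodule.coe_neg, Pi.neg_apply, hg u hu x]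
    rw [sub_eq_add_neg, jetOf_add hf hneg, show (-g : ↥(Hminus ℚ)) = (-1 : ℂ) • g from (neg_one_smul ℂ g).symm, jetOf_smul (-1) hg]
    simp [sub_eq_add_neg]
  have hzero : jetOf s m (f - g) = 0 := by
    funext i
    exact hord i i.2
  rw [hsub] at hzero
  exact sub_eq_zero.mp hzero

end Jets

/-! ### The upper bound -/

section UpperBound

/-- **THE DIMENSION BOUND (abstract key).** Let `s ∈ ℂ`, `m ∈ ℕ` with either `m = 0` or
`0 < Re s < 1, m ≤ ord_s Λ` (so that jets of length `m` are well defined on classes), and assume the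
KEY: every joint eigenvector of `π₋` for `|x|^s` represented by an unramified `f ∈ H₋` with
`ord_s f̂ ≥ m` vanishes. Then `dim (W ∩ J_s) ≤ m` for every finite-dimensional invariant `W ≤ H⁰₋`.
[cite: Meyer2005, Thm. 5.11, §2.3] -/
theorem finrank_inf_jointGenEigenspace_le_of (s : ℂ) (m : ℕ)
    (hwd : m = 0 ∨ (0 < s.re ∧ s.re < 1 ∧ (m : ℕ∞) ≤ analyticOrderAt completedRiemannZeta s))
    (hkey : ∀ (f : ↥(Hminus ℚ)),
      (∀ u ∈ integralFiniteUnits ℚ, ∀ x, (f : IdeleClassGroup ℚ → ℂ) (x * finiteUnitClass ℚ u) = (f : IdeleClassGroup ℚ → ℂ) x) →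
      (∀ g : IdeleClassGroup ℚ, piMinus ℚ μ g (toHzero μ f) = normChar ℚ s g • toHzero μ f) →
      (m : ℕ∞) ≤ analyticOrderAt (mellin (fun t : ℝ => (f : IdeleClassGroup ℚ → ℂ) (posClass (Real.log t)))) s →
      toHzero μ f = 0)
    (W : Submodule ℂ (HzeroMinus ℚ μ)) [FiniteDimensional ℂ W] (hW : ∀ g, W ≤ W.comap (piMinus ℚ μ g)) :
    Module.finrank ℂ ↥(W ⊓ jointGenEigenspace (piMinus ℚ μ) (normChar ℚ s)) ≤ m := by
  classical
  set U : Submodule ℂ (HzeroMinus ℚ μ) := W ⊓ jointGenEigenspace (piMinus ℚ μ) (normChar ℚ s) with hUdef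
  haveI : FiniteDimensional ℂ U := Submodule.finiteDimensional_of_le inf_le_left
  have hUinv : ∀ g, ∀ v ∈ U, (piMinus ℚ μ) g v ∈ U := by
    intro g v hv
    rw [hUdef] at hv ⊢
    have hv' := Submodule.mem_inf.mp hv
    have h2 := jointGenEigenspace_le_comap (piMinus ℚ μ) (normChar ℚ s) g
    exact Submodule.mem_inf.mpr ⟨Submodule.mem_comap.mp (hW g hv'.1), Submodule.mem_comap.mp (h2 hv'.2)⟩
  have hfix : ∀ v ∈ U, ∀ u ∈ integralFiniteUnits ℚ, (piMinus ℚ μ) (finiteUnitClass ℚ u) v = v := by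
    intro v hv u hu
    rw [hUdef] at hv
    exact piMinus_finiteUnitClass_eq_self μ W hW s hv hu
  -- jets are well defined on `U`
  have hjet_wd : ∀ (f g : ↥(Hminus ℚ)),
      (∀ u ∈ integralFiniteUnits ℚ, ∀ x, (f : IdeleClassGroup ℚ → ℂ) (x * finiteUnitClass ℚ u) = (f : IdeleClassGroup ℚ → ℂ) x) →
      (∀ u ∈ integralFiniteUnits ℚ, ∀ x, (g : IdeleClassGroup ℚ → ℂ) (x * finiteUnitClass ℚ u) = (g : IdeleClassGroup ℚ → ℂ) x) →
      toHzero μ f = toHzero μ g → jetOf s m f = jetOf s m g := by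
    intro f g hf hg h
    rcases hwd with rfl | ⟨hs0, hs1, hm⟩
    · funext i; exact i.elim0
    · exact jetOf_eq_of_toHzero_eq μ hs0 hs1 hm hf hg h
  -- the jet map `U →ₗ ℂ^m`
  let rep : U → ↥(Hminus ℚ) := fun v => urep μ v.1 (hfix v.1 v.2)
  have hrep_unr : ∀ v : U, ∀ u ∈ integralFiniteUnits ℚ, ∀ x,
      (rep v : IdeleClassGroup ℚ → ℂ) (x * finiteUnitClass ℚ u) = (rep v : IdeleClassGroup ℚ → ℂ) x :=
    fun v => urep_unramified μ v.1 (hfix v.1 v.2)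
  have hrep_to : ∀ v : U, toHzero μ (rep v) = v.1 := fun v => toHzero_urep μ v.1 (hfix v.1 v.2)
  let Jet : U →ₗ[ℂ] (Fin m → ℂ) :=
    { toFun := fun v => jetOf s m (rep v)
      map_add' := fun v w => by
        have h1 : jetOf s m (rep (v + w)) = jetOf s m (rep v + rep w) := by
          refine hjet_wd _ _ (hrep_unr _) ?_ ?_
          · intro u hu x
            simp only [Submodule.coe_add, Pi.add_apply, hrep_unr v u hu x, hrep_unr w u hu x]
          · rw [map_add, hrep_to, hrep_to, hrep_to]; rfl
        rw [h1, jetOf_add (hrep_unr v) (hrep_unr w)]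
      map_smul' := fun c v => by
        have h1 : jetOf s m (rep (c • v)) = jetOf s m (c • rep v) := by
          refine hjet_wd _ _ (hrep_unr _) ?_ ?_
          · intro u hu x
            simp only [Submodule.coe_smul, Pi.smul_apply, hrep_unr v u hu x]
          · rw [map_smul, hrep_to, hrep_to]; rfl
        rw [h1, jetOf_smul c (hrep_unr v)]
        rfl }
  -- the kernel of `Jet`, pushed into `H⁰₋`, is invariant and consists of classes of order `≥ m`
  set Kr : Submodule ℂ (HzeroMinus ℚ μ) := (LinearMap.ker Jet).map U.subtype with hKr
  have hKrU : Kr ≤ U := by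
    rintro _ ⟨v, -, rfl⟩; exact v.2
  have hKr_ord : ∀ v : U, v.1 ∈ Kr ↔ (m : ℕ∞) ≤ analyticOrderAt (mellin (fun t : ℝ => (rep v : IdeleClassGroup ℚ → ℂ) (posClass (Real.log t)))) s := by
    intro v
    have hmem : v.1 ∈ Kr ↔ v ∈ LinearMap.ker Jet := by
      constructor
      · rintro ⟨w, hw, hwv⟩
        have : w = v := Subtype.ext hwv
        rwa [this] at hw
      · intro hv; exact ⟨v, hv, rfl⟩
    rw [hmem, LinearMap.mem_ker,
      natCast_le_analyticOrderAt_iff_iteratedDeriv_eq_zero ((differentiable_mellin_of_mem_Hminus (hrep_unr v) (rep v).2).analyticAt s)]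
    constructor
    · intro h i hi
      exact congrFun h ⟨i, hi⟩
    · intro h
      funext i
      exact h i i.2
  -- `Kr = ⊥`
  have hKr : Kr = ⊥ := by
    by_contra hne
    -- the commuting family `T g = (piMinus ℚ μ) g - (normChar ℚ s) g` is locally nilpotent on the invariant `Kr`
    let T : IdeleClassGroup ℚ → Module.End ℂ (HzeroMinus ℚ μ) := fun g => (piMinus ℚ μ) g - (normChar ℚ s) g • (1 : Module.End ℂ (HzeroMinus ℚ μ))
    have hcomm : ∀ g h, Commute (T g) (T h) := by
      intro g h
      have hρ' : Commute ((piMinus ℚ μ) g) ((piMinus ℚ μ) h) := by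
        show (piMinus ℚ μ) g * (piMinus ℚ μ) h = (piMinus ℚ μ) h * (piMinus ℚ μ) g
        rw [← map_mul, ← map_mul]
        exact congrArg _ (mul_comm g h)
      exact ((hρ'.sub_left (Commute.smul_left (Commute.one_left _) _)).sub_right
        (Commute.smul_right (Commute.one_right _) _))
    have hKinv : ∀ g, Kr ≤ Kr.comap (T g) := by
      intro g x hx
      rw [Submodule.mem_comap]
      obtain ⟨v, hv, rfl⟩ := hx
      -- `(piMinus ℚ μ) g v ∈ Kr`: the representative `λ_g (rep v)` of `(piMinus ℚ μ) g v` has order `≥ m`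
      have hρv : (piMinus ℚ μ) g (v : HzeroMinus ℚ μ) ∈ U := hUinv g v.1 v.2
      have hρK : (piMinus ℚ μ) g (v : HzeroMinus ℚ μ) ∈ Kr := by
        refine ⟨⟨(piMinus ℚ μ) g v, hρv⟩, ?_, rfl⟩
        show (⟨(piMinus ℚ μ) g v, hρv⟩ : U) ∈ LinearMap.ker Jet
        rw [LinearMap.mem_ker]
        set fv : ↥(Hminus ℚ) := rep v with hfv
        set fg : ↥(Hminus ℚ) := ⟨classTranslate ℚ g fv, classTranslate_mem_ideleClassSchwartzWeighted fv.2 g⟩ with hfg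
        have hfg_unr : ∀ u ∈ integralFiniteUnits ℚ, ∀ x, (fg : IdeleClassGroup ℚ → ℂ) (x * finiteUnitClass ℚ u) = (fg : IdeleClassGroup ℚ → ℂ) x :=
          classTranslate_unramified (hrep_unr v) g
        have hto : toHzero μ fg = toHzero μ (rep ⟨(piMinus ℚ μ) g v, hρv⟩) := by
          rw [hrep_to, hfg, ← piMinus_toHzero, hfv, hrep_to]
        have hjet := hjet_wd fg (rep ⟨(piMinus ℚ μ) g v, hρv⟩) hfg_unr (hrep_unr _) hto
        change jetOf s m (rep ⟨(piMinus ℚ μ) g v, hρv⟩) = 0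
        rw [← hjet]
        -- `ord 𝓜(fg) = ord (|g|^z 𝓜(fv)) ≥ m`
        have hordv : (m : ℕ∞) ≤ analyticOrderAt (mellin (fun t : ℝ => (fv : IdeleClassGroup ℚ → ℂ) (posClass (Real.log t)))) s :=
          (hKr_ord v).mp ⟨v, hv, rfl⟩
        have hmelg : mellin (fun t : ℝ => (fg : IdeleClassGroup ℚ → ℂ) (posClass (Real.log t))) =
            (fun z : ℂ => ((classNorm ℚ g : ℝ) : ℂ) ^ z) * mellin (fun t : ℝ => (fv : IdeleClassGroup ℚ → ℂ) (posClass (Real.log t))) := by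
          funext z; exact mellin_classTranslate_eq (hrep_unr v) g z
        have hc0 : ((classNorm ℚ g : ℝ) : ℂ) ≠ 0 := Complex.ofReal_ne_zero.mpr (classNorm_pos g).ne'
        have hcpow : AnalyticAt ℂ (fun z : ℂ => ((classNorm ℚ g : ℝ) : ℂ) ^ z) s :=
          (Differentiable.analyticAt (fun z => differentiableAt_id.const_cpow (Or.inl hc0)) s)
        have hMg : Differentiable ℂ (mellin (fun t : ℝ => (fg : IdeleClassGroup ℚ → ℂ) (posClass (Real.log t)))) :=
          differentiable_mellin_of_mem_Hminus hfg_unr fg.2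
        have hordg : (m : ℕ∞) ≤ analyticOrderAt (mellin (fun t : ℝ => (fg : IdeleClassGroup ℚ → ℂ) (posClass (Real.log t)))) s := by
          rw [hmelg, analyticOrderAt_mul hcpow ((differentiable_mellin_of_mem_Hminus (hrep_unr v) fv.2).analyticAt s)]
          exact le_add_left hordv
        rw [natCast_le_analyticOrderAt_iff_iteratedDeriv_eq_zero (hMg.analyticAt s)] at hordg
        funext i
        exact hordg i i.2
      -- `T g v = (piMinus ℚ μ) g v - (normChar ℚ s) g v ∈ Kr`
      change ((piMinus ℚ μ) g - (normChar ℚ s) g • (1 : Module.End ℂ (HzeroMinus ℚ μ))) (v : HzeroMinus ℚ μ) ∈ Kr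
      simp only [LinearMap.sub_apply, LinearMap.smul_apply, Module.End.one_apply]
      exact Kr.sub_mem hρK (Kr.smul_mem _ ⟨v, hv, rfl⟩)
    have hKnil : ∀ g, ∀ x ∈ Kr, ∃ n : ℕ, (T g ^ n) x = 0 := by
      intro g x hx
      have hxJ : x ∈ jointGenEigenspace (piMinus ℚ μ) (normChar ℚ s) := by
        have hxU := hKrU hx
        rw [hUdef] at hxU
        exact (Submodule.mem_inf.mp hxU).2
      rw [mem_jointGenEigenspace_iff] at hxJ
      exact hxJ g
    haveI : FiniteDimensional ℂ Kr := Submodule.finiteDimensional_of_le hKrU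
    obtain ⟨v₀, hv₀K, hv₀ne, hTv₀⟩ := exists_common_kernel_vector T hcomm Kr inferInstance hKinv hKnil hne
    have hv₀U : v₀ ∈ U := hKrU hv₀K
    set f₀ : ↥(Hminus ℚ) := rep ⟨v₀, hv₀U⟩ with hf₀
    have hto₀ : toHzero μ f₀ = v₀ := hrep_to ⟨v₀, hv₀U⟩
    have heig : ∀ g, (piMinus ℚ μ) g (toHzero μ f₀) = (normChar ℚ s) g • toHzero μ f₀ := by
      intro g
      have h := hTv₀ g
      change ((piMinus ℚ μ) g - (normChar ℚ s) g • (1 : Module.End ℂ (HzeroMinus ℚ μ))) v₀ = 0 at h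
      simp only [LinearMap.sub_apply, LinearMap.smul_apply, Module.End.one_apply, sub_eq_zero] at h
      rw [hto₀, h]
    have h0 := hkey f₀ (hrep_unr _) heig ((hKr_ord ⟨v₀, hv₀U⟩).mp hv₀K)
    rw [hto₀] at h0
    exact hv₀ne h0
  -- rank–nullity
  have hker : LinearMap.ker Jet = ⊥ := by
    rw [Submodule.eq_bot_iff]
    intro v hv
    have : (v : HzeroMinus ℚ μ) ∈ Kr := ⟨v, hv, rfl⟩
    rw [hKr, Submodule.mem_bot] at this
    exact Subtype.ext this
  have hrn := LinearMap.finrank_range_add_finrank_ker Jet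
  rw [hker, finrank_bot, add_zero] at hrn
  have hrange : Module.finrank ℂ ↥(LinearMap.range Jet) ≤ m := by
    calc Module.finrank ℂ ↥(LinearMap.range Jet) ≤ Module.finrank ℂ (Fin m → ℂ) := Submodule.finrank_le _
      _ = m := Module.finrank_fin_fun ℂ
  change Module.finrank ℂ U ≤ m
  rw [← hrn]
  exact hrange

/-- **THE UPPER BOUND** `mult(|x|^s, π₋) ≤ ord_s Λ` for `0 < Re s < 1`. [cite: Meyer2005, Thm. 5.11] -/
theorem algMultiplicity_le_analyticOrderAt (hμ : μ (adeleFundamentalDomain ℚ) = 1) {s : ℂ} (hs0 : 0 < s.re) (hs1 : s.re < 1) :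
    algMultiplicity (piMinus ℚ μ) (normChar ℚ s) ≤ analyticOrderAt completedRiemannZeta s := by
  have h0 : s ≠ 0 := by rintro rfl; simp at hs0
  have h1 : s ≠ 1 := by rintro rfl; simp at hs1
  obtain ⟨m, hm⟩ := ENat.ne_top_iff_exists.mp (analyticOrderAt_completedZeta_ne_top h0 h1)
  rw [← hm]
  refine algMultiplicity_le_of_forall_finrank_le _ _ m fun W hfin hW => ?_
  haveI := hfin
  refine finrank_inf_jointGenEigenspace_le_of μ s m (Or.inr ⟨hs0, hs1, hm.le⟩) (fun f hf heig hord => ?_) W hW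
  exact toHzero_eq_zero_of_eigenvector μ hμ f hf hs0 heig (Or.inr (Or.inl ⟨hs1, hm ▸ hord⟩))

/-- **No spectrum to the right of the strip**: `mult(|x|^s, π₋) = 0` for `Re s ≥ 1`, `s ≠ 1`.
[cite: Meyer2005, Thm. 5.11] -/
theorem algMultiplicity_eq_zero_of_one_le_re (hμ : μ (adeleFundamentalDomain ℚ) = 1) {s : ℂ} (hs1 : 1 ≤ s.re) (hne1 : s ≠ 1) :
    algMultiplicity (piMinus ℚ μ) (normChar ℚ s) = 0 := by
  refine le_antisymm ?_ zero_le
  have h := algMultiplicity_le_of_forall_finrank_le (piMinus ℚ μ) (normChar ℚ s) 0 fun W hfin hW => by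
    haveI := hfin
    refine finrank_inf_jointGenEigenspace_le_of μ s 0 (Or.inl rfl) (fun f hf heig _ => ?_) W hW
    exact toHzero_eq_zero_of_eigenvector μ hμ f hf (by linarith) heig (Or.inr (Or.inr ⟨hs1, hne1⟩))
  exact_mod_cast h

/-- **`|x| ∉ spec π₋`.** [cite: Meyer2005, Thm. 5.11] -/
theorem normChar_one_not_mem_jointSpectrum (hμ : μ (adeleFundamentalDomain ℚ) = 1) :
    normChar ℚ 1 ∉ jointSpectrum (piMinus ℚ μ) := by
  refine not_mem_jointSpectrum_of_algMultiplicity_eq_zero (le_antisymm ?_ zero_le)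
  have h := algMultiplicity_le_of_forall_finrank_le (piMinus ℚ μ) (normChar ℚ 1) 0 fun W hfin hW => by
    haveI := hfin
    refine finrank_inf_jointGenEigenspace_le_of μ 1 0 (Or.inl rfl) (fun f hf heig _ => ?_) W hW
    exact toHzero_eq_zero_of_eigenvector μ hμ f hf (by simp) heig (Or.inl rfl)
  exact_mod_cast h

end UpperBound


end UpperBoundPart

/-! ## Part 4: the left half plane and the theorem -/


/-! ### The symmetry `J` on `H₋` (for `K = ℚ`) -/

section InvJ

/-- `z(y)⁻¹ = z(-y)`. [folklore] -/
theorem posClass_neg (y : ℝ) : (posClass y)⁻¹ = posClass (-y) := by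
  rw [eq_comm, ← mul_eq_one_iff_eq_inv, ← posClass_add, neg_add_cancel, posClass_zero]

/-- `J f` in the logarithmic coordinate: `Jf(z(y)) = e^{-y} f(z(-y))`. [folklore] -/
theorem invJ_posClass (f : IdeleClassGroup ℚ → ℂ) (y : ℝ) :
    invJ ℚ f (posClass y) = (Real.exp (-y) : ℂ) * f (posClass (-y)) := by
  rw [invJ_apply, posClass_neg, classNorm_posClass, Complex.ofReal_exp, Complex.ofReal_exp, ← Complex.exp_neg]
  push_cast
  ring_nf

/-- `|1| = 1`. [folklore] -/
theorem classNorm_one' : classNorm ℚ (1 : IdeleClassGroup ℚ) = 1 := by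
  have h0 := classNorm_posClass 0
  rwa [posClass_zero, Real.exp_zero] at h0

/-- `|x⁻¹| = |x|⁻¹`. [folklore] -/
theorem classNorm_inv' (x : IdeleClassGroup ℚ) : classNorm ℚ x⁻¹ = (classNorm ℚ x)⁻¹ := by
  have h := classNorm_mul x⁻¹ x
  rw [inv_mul_cancel, classNorm_one'] at h
  field_simp [classNorm_ne_zero x] at h ⊢
  linarith

/-- `J` is an involution. [folklore] -/
theorem invJ_invJ (f : IdeleClassGroup ℚ → ℂ) : invJ ℚ (invJ ℚ f) = f := by
  funext x
  simp only [invJ_apply, classNorm_inv', Complex.ofReal_inv]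
  have hx : ((classNorm ℚ x : ℝ) : ℂ) ≠ 0 := Complex.ofReal_ne_zero.mpr (classNorm_ne_zero x)
  have hinv : f x⁻¹⁻¹ = f x := congrArg f (inv_inv x)
  rw [hinv]
  field_simp

/-- `J` preserves unramifiedness. [folklore] -/
theorem invJ_unramified {f : IdeleClassGroup ℚ → ℂ}
    (hunr : ∀ u ∈ integralFiniteUnits ℚ, ∀ x, f (x * finiteUnitClass ℚ u) = f x) :
    ∀ u ∈ integralFiniteUnits ℚ, ∀ x, invJ ℚ f (x * finiteUnitClass ℚ u) = invJ ℚ f x := by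
  intro u hu x
  rw [invJ_apply, invJ_apply, classNorm_mul, classNorm_finiteUnitClass hu, mul_one]
  congr 1
  have e : (x * finiteUnitClass ℚ u)⁻¹ = x⁻¹ * finiteUnitClass ℚ u⁻¹ := by
    rw [map_inv]; exact mul_inv x (finiteUnitClass ℚ u)
  rw [e]
  exact hunr u⁻¹ (inv_mem hu) x⁻¹

/-- Reflection `y ↦ -y` preserves super-exponential decay. [folklore] -/
theorem IsSuperExp.comp_neg {φ : ℝ → ℂ} (hφ : IsSuperExp φ) : IsSuperExp fun y => φ (-y) := by
  refine ⟨hφ.contDiff.comp contDiff_neg, fun n β α => ?_⟩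
  obtain ⟨C, hC⟩ := hφ.decay n β (-α)
  refine ⟨C, fun y => ?_⟩
  have h := hC (-y)
  rw [abs_neg, show -α * -y = α * y by ring] at h
  rw [iteratedDeriv_comp_neg, norm_smul, norm_pow, norm_neg, norm_one, one_pow, one_mul]
  exact h

/-- Multiplication by `e^{cy}` preserves super-exponential decay. [folklore] -/
theorem IsSuperExp.mul_exp {φ : ℝ → ℂ} (hφ : IsSuperExp φ) (c : ℝ) : IsSuperExp fun y => φ y * (Real.exp (c * y) : ℂ) := by
  rw [isSuperExp_iff_transfer] at hφ ⊢
  intro α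
  have hfun : (fun y : ℝ => φ y * (Real.exp (c * y) : ℂ) * (Real.exp (α * y) : ℂ)) =
      fun y : ℝ => φ y * (Real.exp ((c + α) * y) : ℂ) := by
    funext y
    rw [mul_assoc, ← Complex.ofReal_mul, ← Real.exp_add]
    congr 3
    ring
  rw [hfun]
  exact hφ (c + α)

/-- **`J` preserves `H₋`** (for unramified functions). [cite: Meyer2005, §4] -/
theorem invJ_mem_Hminus {f : IdeleClassGroup ℚ → ℂ}
    (hunr : ∀ u ∈ integralFiniteUnits ℚ, ∀ x, f (x * finiteUnitClass ℚ u) = f x) (hf : f ∈ Hminus ℚ) :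
    invJ ℚ f ∈ Hminus ℚ := by
  rw [mem_Hminus_iff_isSuperExp (invJ_unramified hunr)]
  have hφ := (mem_Hminus_iff_isSuperExp hunr).mp hf
  have h := (hφ.comp_neg.mul_exp (-1))
  refine (show (fun y : ℝ => invJ ℚ f (posClass y)) = fun y : ℝ => f (posClass (-y)) * (Real.exp (-1 * y) : ℂ) from ?_) ▸ h
  funext y
  rw [invJ_posClass, neg_one_mul, mul_comm]

/-- **Mellin transform of `Jf`**: `𝓜(Jf)(z) = 𝓜f(1 - z)` (`f ∈ H₋` unramified; both entire). [folklore] -/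
theorem mellin_invJ {f : IdeleClassGroup ℚ → ℂ} (z : ℂ) :
    mellin (fun t : ℝ => invJ ℚ f (posClass (Real.log t))) z = mellin (fun t : ℝ => f (posClass (Real.log t))) (1 - z) := by
  rw [mellin_eq_laplace, mellin_eq_laplace, laplace, laplace, ← integral_neg_eq_self]
  refine integral_congr_ae (Eventually.of_forall fun y => ?_)
  simp only [invJ_posClass, neg_neg, Complex.ofReal_exp, Complex.ofReal_neg]
  rw [mul_comm (cexp _) (f _), mul_assoc, ← Complex.exp_add]
  congr 2
  ring

end InvJ

/-! ### The key lemma on the left half plane -/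

section Left

variable [MeasurableSpace (AdeleRing (𝓞 ℚ) ℚ)] [BorelSpace (AdeleRing (𝓞 ℚ) ℚ)]
  (μ : Measure (AdeleRing (𝓞 ℚ) ℚ)) [μ.IsAddHaarMeasure]

/-- **The eigen-equation through the SECOND component of `i₊`**: if `[i₋ f]` is an eigenvector of
`π₋(z(e^a))` with eigenvalue `e^{as}`, then `Jf` satisfies
`(e^{aw} - e^{a(1-s)}) 𝓜(Jf)(w) = ζ(w) Mκ(w)` on `Re w > 1` for an even Schwartz `κ`.
[cite: Meyer2005, §4, Thm. 5.11] -/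
theorem exists_schwartz_of_eigen_invJ (f : ↥(Hminus ℚ))
    (hunr : ∀ u ∈ integralFiniteUnits ℚ, ∀ x, (f : IdeleClassGroup ℚ → ℂ) (x * finiteUnitClass ℚ u) = (f : IdeleClassGroup ℚ → ℂ) x)
    (s : ℂ) (a : ℝ)
    (heig : piMinus ℚ μ (posClass a) (toHzero μ f) = cexp (a * s) • toHzero μ f) :
    ∃ κ : SchwartzMap ℝ ℂ, (∀ t, κ (-t) = κ t) ∧
      ∀ w : ℂ, 1 < w.re → (cexp (a * w) - cexp (a * (1 - s))) * mellin (fun t : ℝ => invJ ℚ (f : IdeleClassGroup ℚ → ℂ) (posClass (Real.log t))) w =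
        riemannZeta w * mellin (fun t : ℝ => κ t) w := by
  set g : IdeleClassGroup ℚ := posClass a with hg
  set D : ↥(Hminus ℚ) := ⟨classTranslate ℚ g f, classTranslate_mem_ideleClassSchwartzWeighted f.2 g⟩ - cexp (a * s) • f with hD
  have hD0 : toHzero μ D = 0 := by
    rw [hD, map_sub, map_smul, ← piMinus_toHzero, heig, sub_self]
  have hDplus := iMinus_mem_Hplus_of_toHzero_eq_zero μ hD0
  have hDfun : (D : IdeleClassGroup ℚ → ℂ) = classTranslate ℚ g f - cexp (a * s) • (f : IdeleClassGroup ℚ → ℂ) := by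
    rw [hD]; rfl
  have hDunr : ∀ u ∈ integralFiniteUnits ℚ, ∀ x, (D : IdeleClassGroup ℚ → ℂ) (x * finiteUnitClass ℚ u) = (D : IdeleClassGroup ℚ → ℂ) x := by
    intro u hu x
    rw [hDfun]
    simp only [Pi.sub_apply, Pi.smul_apply, classTranslate_unramified hunr g u hu x, hunr u hu x]
  obtain ⟨F, hF, hDF⟩ := (mem_Hplus_iff (μ := μ)).mp hDplus
  -- second component: `D = J Σ(𝔉F)`, so `Σ(𝔉F) = J D`
  have hD2 : (D : IdeleClassGroup ℚ → ℂ) = invJ ℚ (meyerSum ℚ (adeleFourier ℚ μ F)) := by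
    have := congrArg Prod.snd hDF
    rw [iMinus_apply] at this
    exact this
  have hSF : meyerSum ℚ (adeleFourier ℚ μ F) = invJ ℚ (D : IdeleClassGroup ℚ → ℂ) := by
    rw [hD2, invJ_invJ]
  have hFhat : adeleFourier ℚ μ F ∈ schwartzBruhatAdele ℚ := adeleFourier_mem_schwartzBruhatAdele μ hF
  have hSunr : ∀ u ∈ integralFiniteUnits ℚ, ∀ x, meyerSum ℚ (adeleFourier ℚ μ F) (x * finiteUnitClass ℚ u) = meyerSum ℚ (adeleFourier ℚ μ F) x := by
    rw [hSF]; exact invJ_unramified hDunr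
  obtain ⟨κ, hκeven, hκ⟩ := exists_schwartz_mellin_meyerSum hFhat hSunr
  -- `κ̃(t) = -e^{-as} κ(e^{-a} t)`
  have hc : (0 : ℝ) < Real.exp (-a) := Real.exp_pos _
  refine ⟨(-cexp (-(a * s))) • dilSchwartz (Real.exp (-a)) hc.ne' κ, fun t => by simp [dilSchwartz_apply, hκeven], fun w hw => ?_⟩
  -- `𝓜(J D)(w) = 𝓜D(1-w) = (e^{a(1-w)} - e^{as}) 𝓜f(1-w) = (e^{a(1-w)} - e^{as}) 𝓜(Jf)(w)`
  have hMD : ∀ z : ℂ, mellin (fun t : ℝ => (D : IdeleClassGroup ℚ → ℂ) (posClass (Real.log t))) z =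
      (cexp (a * z) - cexp (a * s)) * mellin (fun t : ℝ => (f : IdeleClassGroup ℚ → ℂ) (posClass (Real.log t))) z := by
    intro z
    rw [hDfun]
    have h1 := mellin_sub_of_mem_Hminus (classTranslate_unramified hunr g) (classTranslate_mem_ideleClassSchwartzWeighted f.2 g)
      (f := classTranslate ℚ g f) (g := cexp (a * s) • (f : IdeleClassGroup ℚ → ℂ))
      (fun u hu x => by simp only [Pi.smul_apply, hunr u hu x]) (Submodule.smul_mem _ _ f.2) z
    rw [h1, mellin_classTranslate_eq hunr g z, ofReal_classNorm_cpow, hg, classNorm_posClass, Real.log_exp]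
    have h2 : mellin (fun t : ℝ => (cexp (a * s) • (f : IdeleClassGroup ℚ → ℂ)) (posClass (Real.log t))) z =
        cexp (a * s) * mellin (fun t : ℝ => (f : IdeleClassGroup ℚ → ℂ) (posClass (Real.log t))) z := by
      rw [mellin, mellin, ← integral_const_mul]
      refine setIntegral_congr_fun measurableSet_Ioi fun t _ => ?_
      simp only [Pi.smul_apply, smul_eq_mul]; ring
    rw [h2]; ring
  have hκw := hκ w hw
  rw [hSF, mellin_invJ, hMD, ← mellin_invJ] at hκw
  -- Mellin of the dilated `κ`
  have hdil : mellin (fun t : ℝ => ((-cexp (-(a * s))) • dilSchwartz (Real.exp (-a)) hc.ne' κ) t) w =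
      -cexp (-(a * s)) * (cexp (a * w) * mellin (fun t : ℝ => κ t) w) := by
    have h := mellin_comp_mul_left (fun t : ℝ => κ t) w hc
    rw [smul_eq_mul, ofReal_exp_neg_cpow] at h
    rw [← h, mellin, mellin, ← integral_const_mul]
    refine setIntegral_congr_fun measurableSet_Ioi fun t _ => ?_
    simp only [smul_apply, dilSchwartz_apply, smul_eq_mul]; ring
  rw [hdil]
  have e1 : cexp (-(a * s)) * cexp (a * w) * cexp (a * (1 - w)) = cexp (a * (1 - s)) := by
    rw [← Complex.exp_add, ← Complex.exp_add]; congr 1; ring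
  have e2 : cexp (-(a * s)) * cexp (a * w) * cexp (a * s) = cexp (a * w) := by
    rw [← Complex.exp_add, ← Complex.exp_add]; congr 1; ring
  rw [show cexp (a * w) - cexp (a * (1 - s)) = -cexp (-(a * s)) * cexp (a * w) * (cexp (a * (1 - w)) - cexp (a * s)) by
    linear_combination e1 - e2]
  linear_combination (-cexp (-(a * s)) * cexp (a * w)) * hκw

/-- **THE KEY LEMMA ON THE LEFT HALF PLANE.** A joint eigenvector of `π₋` for `|x|^s` with
`Re s ≤ 0`, represented by an unramified `f ∈ H₋`, vanishes. [cite: Meyer2005, Thm. 5.11, §4] -/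
theorem toHzero_eq_zero_of_eigenvector_left (hμ : μ (adeleFundamentalDomain ℚ) = 1) (f : ↥(Hminus ℚ))
    (hunr : ∀ u ∈ integralFiniteUnits ℚ, ∀ x, (f : IdeleClassGroup ℚ → ℂ) (x * finiteUnitClass ℚ u) = (f : IdeleClassGroup ℚ → ℂ) x)
    {s : ℂ} (hs : s.re ≤ 0)
    (heig : ∀ g : IdeleClassGroup ℚ, piMinus ℚ μ g (toHzero μ f) = normChar ℚ s g • toHzero μ f) :
    toHzero μ f = 0 := by
  have heig' : ∀ a : ℝ, piMinus ℚ μ (posClass a) (toHzero μ f) = cexp (a * s) • toHzero μ f := by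
    intro a
    rw [heig, normChar_eq_exp, classNorm_posClass, Real.log_exp]
  obtain ⟨κ₁, hκ₁e, hκ₁⟩ := exists_schwartz_of_eigen_invJ μ f hunr s 1 (heig' 1)
  obtain ⟨κ₂, -, hκ₂⟩ := exists_schwartz_of_eigen_invJ μ f hunr s (Real.sqrt 2) (heig' (Real.sqrt 2))
  have hgunr := invJ_unramified hunr
  set g : ↥(Hminus ℚ) := ⟨invJ ℚ (f : IdeleClassGroup ℚ → ℂ), invJ_mem_Hminus hunr f.2⟩ with hg
  have hs' : 0 < (1 - s).re := by simp; linarith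
  have hcase : (1 - s) = 1 ∨ ((1 - s).re < 1 ∧ analyticOrderAt completedRiemannZeta (1 - s) ≤
      analyticOrderAt (mellin (fun t : ℝ => (g : IdeleClassGroup ℚ → ℂ) (posClass (Real.log t)))) (1 - s)) ∨
      (1 ≤ (1 - s).re ∧ (1 - s) ≠ 1) := by
    by_cases h0 : s = 0
    · left; rw [h0, sub_zero]
    · right; right
      refine ⟨by simp only [Complex.sub_re, Complex.one_re]; linarith, fun h => h0 ?_⟩
      linear_combination -h
  obtain ⟨k, hkeven, hk0, hkint, hgeq⟩ :=
    exists_theta_of_mellin_identities μ hμ g hgunr hs' κ₁ κ₂ hκ₁e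
      (fun z hz => by have h := hκ₁ z hz; simp only [Complex.ofReal_one, one_mul] at h; exact h) hκ₂ hcase
  -- `hgeq : J f = Σ(k ⊗ 1_Ẑ)`; the theta functional equation
  obtain ⟨Λ₁, Λ₂, hΛ₁, hΛ₂, hΛ₁eq, hΛ₂eq, hFE⟩ := exists_entire_thetaFE k hkeven hk0 hkint
  have hMg : ∀ z : ℂ, mellin (fun t : ℝ => invJ ℚ (f : IdeleClassGroup ℚ → ℂ) (posClass (Real.log t))) z = Λ₁ z := by
    have hdiff : Differentiable ℂ (fun z => mellin (fun t : ℝ => invJ ℚ (f : IdeleClassGroup ℚ → ℂ) (posClass (Real.log t))) z - Λ₁ z) :=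
      (differentiable_mellin_of_mem_Hminus hgunr g.2).sub hΛ₁
    have hzero := eq_zero_of_differentiable_of_eqOn_lt_re hdiff 1 fun z hz => by
      rw [hΛ₁eq z hz, show invJ ℚ (f : IdeleClassGroup ℚ → ℂ) = (g : IdeleClassGroup ℚ → ℂ) from rfl, hgeq,
        mellin_meyerSum_ratTensor_schwartz k hkeven hz, sub_self]
    intro z
    exact sub_eq_zero.mp (hzero z)
  -- `𝓕k` is an even Schwartz function with `𝓕k(0) = 0 = ∫ 𝓕k`
  set kh : SchwartzMap ℝ ℂ := 𝓕 k with hkh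
  have hkh_even : ∀ t, kh (-t) = kh t := fourier_schwartz_even k hkeven
  have hkh0 : kh 0 = 0 := by
    change 𝓕 (⇑k) 0 = 0
    rw [fourier_apply_zero, hkint]
  have hkhint : ∫ t : ℝ, kh t = 0 := by
    change ∫ ξ : ℝ, 𝓕 (⇑k) ξ = 0
    rw [integral_fourier_eq, hk0]
  have hhmem : meyerSum ℚ (ratTensor kh) ∈ Hminus ℚ := meyerSum_ratTensor_mem_Hminus (μ := μ) hμ kh hkh0 hkhint
  have hhplus : iMinus ℚ (meyerSum ℚ (ratTensor kh)) ∈ Hplus ℚ μ := iMinus_meyerSum_ratTensor_mem_Hplus μ hμ kh hkh0 hkhint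
  have hhunr : ∀ u ∈ integralFiniteUnits ℚ, ∀ x, meyerSum ℚ (ratTensor kh) (x * finiteUnitClass ℚ u) = meyerSum ℚ (ratTensor kh) x :=
    fun u hu x => meyerSum_ratTensor_mul_finiteUnitClass (⇑kh) hu x
  -- `𝓜f(z) = 𝓜(Jf)(1-z) = Λ₁(1-z) = Λ₂(z) = 2ζ(z) M(𝓕k)(z)` on `Re z > 1`
  have hfeq : (f : IdeleClassGroup ℚ → ℂ) = meyerSum ℚ (ratTensor kh) := by
    refine eq_of_mellin_eqOn hunr f.2 hhunr hhmem fun z hz => ?_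
    have h1 : mellin (fun t : ℝ => (f : IdeleClassGroup ℚ → ℂ) (posClass (Real.log t))) z =
        mellin (fun t : ℝ => invJ ℚ (f : IdeleClassGroup ℚ → ℂ) (posClass (Real.log t))) (1 - z) := by
      conv_lhs => rw [← invJ_invJ (f : IdeleClassGroup ℚ → ℂ)]
      rw [mellin_invJ]
    rw [h1, hMg, hFE, hΛ₂eq z hz, mellin_meyerSum_ratTensor_schwartz kh hkh_even hz]
  have hfsub : f = ⟨meyerSum ℚ (ratTensor kh), hhmem⟩ := Subtype.ext hfeq
  rw [hfsub]
  exact toHzero_eq_zero μ hhplus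

/-- **No spectrum on the left half plane**: `mult(|x|^s, π₋) = 0` for `Re s ≤ 0`. [cite: Meyer2005, Thm. 5.11] -/
theorem algMultiplicity_eq_zero_of_re_nonpos (hμ : μ (adeleFundamentalDomain ℚ) = 1) {s : ℂ} (hs : s.re ≤ 0) :
    algMultiplicity (piMinus ℚ μ) (normChar ℚ s) = 0 := by
  refine le_antisymm ?_ zero_le
  have h := algMultiplicity_le_of_forall_finrank_le (piMinus ℚ μ) (normChar ℚ s) 0 fun W hfin hW => by
    haveI := hfin
    refine finrank_inf_jointGenEigenspace_le_of μ s 0 (Or.inl rfl) (fun f hf heig _ => ?_) W hW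
    exact toHzero_eq_zero_of_eigenvector_left μ hμ f hf hs heig
  exact_mod_cast h

/-- **`1 = |x|^0 ∉ spec π₋`.** [cite: Meyer2005, Thm. 5.11] -/
theorem normChar_zero_not_mem_jointSpectrum (hμ : μ (adeleFundamentalDomain ℚ) = 1) :
    normChar ℚ 0 ∉ jointSpectrum (piMinus ℚ μ) :=
  not_mem_jointSpectrum_of_algMultiplicity_eq_zero (algMultiplicity_eq_zero_of_re_nonpos μ hμ (by simp))

end Left

/-! ### The spectral realisation theorem -/

/-- **MEYER'S SPECTRAL REALISATION THEOREM FOR `K = ℚ`** ([Meyer2005, Thm. 5.11] with the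
unramified quasi-character `|x|^s`): the algebraic multiplicity of `|x|^s` in `π₋` equals `ord_s Λ`
for `s ∉ {0, 1}`, and `1, |x|` are not in the spectrum of `π₋`. Discharges the named fact
`spectralRealisation_rat`. [cite: Meyer2005, Thm. 5.11] -/
theorem spectralRealisation_rat_holds : spectralRealisation_rat := by
  intro _ _ μ _ hμ
  refine ⟨fun s h0 h1 => ?_, normChar_zero_not_mem_jointSpectrum μ hμ, normChar_one_not_mem_jointSpectrum μ hμ⟩
  by_cases hstrip : 0 < s.re ∧ s.re < 1
  · exact le_antisymm (algMultiplicity_le_analyticOrderAt μ hμ hstrip.1 hstrip.2)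
      (analyticOrderAt_completedZeta_le_algMultiplicity μ hμ h0 h1)
  · have hout : s.re ≤ 0 ∨ 1 ≤ s.re := by
      rcases le_or_gt s.re 0 with h | h
      · exact Or.inl h
      · exact Or.inr (le_of_not_gt fun h1' => hstrip ⟨h, h1'⟩)
    rw [analyticOrderAt_completedZeta_eq_zero h0 h1 hout]
    rcases hout with h | h
    · exact_mod_cast algMultiplicity_eq_zero_of_re_nonpos μ hμ h
    · exact_mod_cast algMultiplicity_eq_zero_of_one_le_re μ hμ h h1


end Literature.NumberTheory.Automorphic.Meyer
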